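import Literature.Analysis.FunctionSpaces.MeyersSerrinProofs
import Literature.Analysis.FunctionSpaces.SobolevDomainNormProofs
import Mathlib.MeasureTheory.Function.ConvergenceInMeasure
import Mathlib.Analysis.InnerProductSpace.PiL2
import Mathlib.MeasureTheory.Integral.Bochner.Set
import Mathlib.MeasureTheory.Measure.Haar.InnerProductSpace
import Mathlib.MeasureTheory.Function.Floor
import Mathlib.MeasureTheory.Function.LpSpace.Basic
import Literature.MathematicalPhysics.QuantumFieldTheory.Balaban1983to89.B4Eq19LatticeOperators
import Mathlib.Analysis.Calculus.ContDiff.Basic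
import Mathlib.Analysis.Calculus.MeanValue
import Mathlib.Topology.UniformSpace.HeineCantor
import Mathlib.MeasureTheory.Function.LpSeminorm.Indicator
import Literature.Analysis.FunctionSpaces.DiagonalWeakLimits
import Mathlib.MeasureTheory.Function.ContinuousMapDense
import Mathlib.MeasureTheory.Function.L2Space
import Literature.Analysis.FunctionSpaces.SobolevDomainProofs
import Literature.Analysis.FunctionSpaces.SobolevDifferenceQuotients
import HarnessLib

/-!
# Energy minimising maps `Q → S³`, I: Rellich nets, dyadic means, weak gradients, extraction on the cube (re-homed proofs)

**Compactness of energy minimising maps `Q → S³` (Luckhaus 1988; Simon, *Theorems on Regularity and Singularity of Energy Minimizing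
Maps* (1996), §2.9 Lemma 1 with Remarks (1)–(2)), proved along Hardt–Kinderlehrer–Lin (Comm. Math. Phys. 105 (1986), §2) — the named fact
`Literature.Analysis.PDE.MinimisingMapCompactness` (`HarmonicMapMinimisers.lean`) HOLDS, EXACT name `Literature.Analysis.PDE.MinimisingMapCompactness_holds`
(file 3; this is file 1 of 3).**  Every sequence of finite-energy unit `W^{1,2}` maps on the open unit cube `Q ⊂ ℝ³`, each minimising the Dirichlet energy on every
ball `B̄_ρ(y) ⊆ Q` against unit competitors agreeing with it off a smaller concentric ball, with bounded energies, has a subsequence converging in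
`L²` on every such ball to a minimiser of the same class, with convergence of the energies [Simon1996] [Luckhaus1988] [HardtKinderlehrerLin1986].
Contents of the three files: (I) interior Rellich–Kondrachov in net form and strong `L²` compactness for sequences bounded in `L^∞ ∩ W^{1,2}`
[Evans2010], dyadic cells / dyadic means and weak limits, the everywhere-unit representative and locality of weak gradients, extraction on the
cube; (II) competitor transfer (the ball-splitting inequality), the radial pigeonhole, energy convergence and ball-minimality of the limit modulo
the Hardt–Kinderlehrer–Lin shell-competitor hypothesis, the compactness theorem modulo that hypothesis, the Sobolev shell interpolant, HKL averaging,
the sphere ray projection; (III) the nonlinear Sobolev chain rule [Ziemer1989] [EvansGariepy1992], the ray-projection calculus, the HKL shell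
competitor, and `MinimisingMapCompactness_holds`.
RE-HOMED into `Literature/` by the Hodge foundations lane (`lit-hodgefound`, seat p20, generation 40): verbatim DECLARATION-LEVEL ports (the 149
theorems needed, in dependency order; each Part is one Summits module) of 30 theorem-only modules
`Summits/QuantumFields/YangMills/Theorems/PoincareLipschitz{SobolevLocalL2Net,SobolevL2Compactness,BlowDownCells,SamplingCells,BlowDownModulus,
BlowDownL2Compactness,DyadicMeansWeakLimit(Cube),LatticeToContinuumSobolevLetters,BlowDownWeakGradientLetters,SobolevCubeExtraction(Letters),
CompetitorTransfer,ShellPigeonhole,MinimisingMapCompactness{Letters,Energy,Minimality,∅,Holds},SobolevShellInterpolation(Balls),ProjectionAveraging(Continuum),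
SphereRayProjection(Calculus),WeakChainRuleShear,SobolevChainRule(ByApproximation),SobolevRayProjectionComp,HKLCompetitor}.lean`; the thirty module
namespaces `Summit.QuantumFields.YangMills.Theorems.PoincareLipschitz*` are COLLAPSED into the single namespace `Literature.Analysis.PDE.MinimisingMaps`
(short names are pairwise distinct; the intra-cone `open … (…)` lines are dropped).  Theorem-only files: no definition, no new named fact (D-0026);
imports Mathlib/Literature only (`Literature/Analysis/FunctionSpaces/{MeyersSerrin,SobolevDomain*,SobolevDifferenceQuotients,SobolevTraceDensity,
WeakDerivInner,DiagonalWeakLimits}`, `Literature/Analysis/Calculus/RadialCutoff`, `Literature/MathematicalPhysics/QuantumFieldTheory/Balaban1983to89/B4Eq19LatticeOperators`);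
every declaration carries the citation of the printed statement it formalises or serves.  The Summits originals stay in place (transitional
duplication).  WHAT THIS IS NOT: nothing here bears on Yang–Mills existence or the mass gap or any summit statement; it is the variational
compactness theory of harmonic maps into `S³` on the unit cube of `ℝ³` (the companion fact `MinimisingMapSmoothness`, Schoen–Uhlenbeck 1984,
remains a named fact).
-/

noncomputable section

/-!
## Part 1 — port of `Summits/QuantumFields/YangMills/Theorems/PoincareLipschitzSobolevLocalL2Net.lean` (4 declarations kept)

# Energy minimising maps into `S³` (Hardt–Kinderlehrer–Lin / Luckhaus / Simon §2.9): Sobolev Local L2 Net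

Declarations of this Part (verbatim port; each keeps its own docstring and citation): `opNorm_le_sum_basis`, `eLpNorm_clm_le_sum_basis`, `contDiff_one_cutoff_smul`, `exists_finset_eLpNorm_sub_lt_of_weakGrad`.

Reference keys (see `references.bib` and the declarations' citations): [Evans2010], [Adams1975], [Simon1996].
-/

section Part1

open _root_.MeasureTheory _root_.Set _root_.Function _root_.Filter _root_.Topology _root_.Metric _root_.TopologicalSpace
open scoped _root_.ContDiff _root_.ENNReal

namespace Literature.Analysis.PDE.MinimisingMaps

open Literature.Analysis.FunctionSpaces

variable {E : Type*} [NormedAddCommGroup E] [NormedSpace ℝ E] [FiniteDimensional ℝ E]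
  [MeasurableSpace E] [BorelSpace E] {μ : Measure E} [μ.IsAddHaarMeasure]
variable {F : Type*} [NormedAddCommGroup F] [NormedSpace ℝ F] [CompleteSpace F]

/-! ## §1 Letters -/

omit [MeasurableSpace E] [BorelSpace E] [CompleteSpace F] in
/-- **Operator norm against a basis**: `‖T‖ ≤ Σ_i ‖b*_i‖·‖T b_i‖` for the basis `Module.finBasis` and its (continuous)
coordinate functionals `b*_i`, via `v = Σ_i b*_i(v) b_i`. [cite: Evans2010, §5.7 Theorem 1; Adams1975, Theorem 6.2] -/
theorem opNorm_le_sum_basis (T : E →L[ℝ] F) :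
    ‖T‖ ≤ ∑ i, ‖LinearMap.toContinuousLinearMap ((Module.finBasis ℝ E).coord i)‖ * ‖T ((Module.finBasis ℝ E) i)‖ := by
  set b := Module.finBasis ℝ E
  refine ContinuousLinearMap.opNorm_le_bound _ (Finset.sum_nonneg fun i _ => by positivity) fun v => ?_
  have hv : T v = ∑ i, b.repr v i • T (b i) := by
    conv_lhs => rw [← b.sum_repr v]
    rw [map_sum]
    exact Finset.sum_congr rfl fun i _ => by rw [map_smul]
  rw [hv, Finset.sum_mul]
  refine (norm_sum_le _ _).trans (Finset.sum_le_sum fun i _ => ?_)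
  rw [norm_smul, Real.norm_eq_abs]
  have h1 : |b.repr v i| ≤ ‖LinearMap.toContinuousLinearMap (b.coord i)‖ * ‖v‖ := by
    have := (LinearMap.toContinuousLinearMap (b.coord i)).le_opNorm v
    rwa [LinearMap.coe_toContinuousLinearMap', Module.Basis.coord_apply, Real.norm_eq_abs] at this
  calc |b.repr v i| * ‖T (b i)‖ ≤ (‖LinearMap.toContinuousLinearMap (b.coord i)‖ * ‖v‖) * ‖T (b i)‖ :=
        mul_le_mul_of_nonneg_right h1 (norm_nonneg _)
    _ = ‖LinearMap.toContinuousLinearMap (b.coord i)‖ * ‖T (b i)‖ * ‖v‖ := by ring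

omit [BorelSpace E] [CompleteSpace F] in
/-- **`L^p` norm of an operator field against a basis**: `‖T‖_{L^p(ν)} ≤ Σ_i ‖b*_i‖·‖T b_i‖_{L^p(ν)}`. [cite: Evans2010, §5.7 Theorem 1; Adams1975, Theorem 6.2] -/
theorem eLpNorm_clm_le_sum_basis (ν : Measure E) {T : E → E →L[ℝ] F}
    (hT : ∀ i, AEStronglyMeasurable (fun x => T x ((Module.finBasis ℝ E) i)) ν) (p : ℝ≥0∞) (hp : 1 ≤ p) :
    eLpNorm T p ν ≤ ∑ i, ‖LinearMap.toContinuousLinearMap ((Module.finBasis ℝ E).coord i)‖ₑ *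
      eLpNorm (fun x => T x ((Module.finBasis ℝ E) i)) p ν := by
  set b := Module.finBasis ℝ E
  set c : Fin (Module.finrank ℝ E) → ℝ := fun i => ‖LinearMap.toContinuousLinearMap (b.coord i)‖ with hc
  have hc0 : ∀ i, 0 ≤ c i := fun i => norm_nonneg _
  have h1 : eLpNorm T p ν ≤ eLpNorm (fun x => ∑ i, c i * ‖T x (b i)‖) p ν := by
    exact eLpNorm_mono_real fun x => (opNorm_le_sum_basis (T x)).trans (le_of_eq rfl)
  refine h1.trans ?_
  have h2 : (fun x => ∑ i, c i * ‖T x (b i)‖) = ∑ i, (fun x => c i * ‖T x (b i)‖) := by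
    funext x; simp [Finset.sum_apply]
  rw [h2]
  refine (eLpNorm_sum_le (fun i _ => ((hT i).norm.const_mul _)) hp).trans (Finset.sum_le_sum fun i _ => ?_)
  have h3 : (fun x => c i * ‖T x (b i)‖) = c i • (fun x => ‖T x (b i)‖) := by
    funext x; simp [smul_eq_mul]
  rw [h3, eLpNorm_const_smul, eLpNorm_norm, Real.enorm_eq_ofReal (hc0 i), ofReal_norm]

omit [FiniteDimensional ℝ E] [MeasurableSpace E] [BorelSpace E] [CompleteSpace F] in
/-- **A compactly supported smooth cut-off times a function smooth on a neighbourhood of its support is globally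
smooth** (the standard extension-by-zero; cf. lit `CompactCutoffExtension.contDiff_smul_of_tsupport_subset`, restated in
the `C¹` form used here). [cite: Evans2010, §5.7 Theorem 1; Adams1975, Theorem 6.2] -/
theorem contDiff_one_cutoff_smul {χ : E → ℝ} {g : E → F} {O : Set E} (hO : IsOpen O) (hχ : ContDiff ℝ 1 χ)
    (hχO : tsupport χ ⊆ O) (hg : ContDiffOn ℝ 1 g O) : ContDiff ℝ 1 fun x => χ x • g x := by
  rw [contDiff_iff_contDiffAt]
  intro x
  by_cases hx : x ∈ O
  · exact hχ.contDiffAt.smul (hg.contDiffAt (hO.mem_nhds hx))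
  · have hx' : x ∉ tsupport χ := fun h => hx (hχO h)
    have h0 : (fun y => χ y • g y) =ᶠ[𝓝 x] fun _ => 0 := by
      have : ∀ᶠ y in 𝓝 x, χ y = 0 := by
        have hopen : IsOpen (tsupport χ)ᶜ := (isClosed_tsupport χ).isOpen_compl
        filter_upwards [hopen.mem_nhds hx'] with y hy
        exact image_eq_zero_of_notMem_tsupport hy
      filter_upwards [this] with y hy
      rw [hy, zero_smul]
    exact (contDiffAt_const.congr_of_eventuallyEq h0)

/-! ## §2 The local `L²` net -/

/-- **LOCAL `L²` NETS FOR SEQUENCES BOUNDED IN `L^∞ ∩ W^{1,2}` (interior Rellich–Kondrachov, net form).**  Let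
`u_j : E → F` have weak gradients `Gs_j` on the open `Ω`, `‖u_j x‖ ≤ B` on `Ω`, `‖Gs_j‖_{L²(Ω)} ≤ Λ < ∞`, and let
`K ⊆ Ω` be compact.  Then for every `ε > 0` there is a finite index set `s` with: every `u_j` is within `ε` of some
`u_m`, `m ∈ s`, in `L²(K)`. [cite: Evans2010, §5.7 Theorem 1; Adams1975, Theorem 6.2] -/
theorem exists_finset_eLpNorm_sub_lt_of_weakGrad [FiniteDimensional ℝ F] {Ω : Opens E} {u : ℕ → E → F}
    {Gs : ℕ → E → E →L[ℝ] F} (hu : ∀ j, HasWeakFDerivOn Ω μ (u j) (Gs j)) {B : ℝ}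
    (hB : ∀ j, ∀ x ∈ (Ω : Set E), ‖u j x‖ ≤ B) {Λ : ℝ≥0∞} (hΛ : Λ ≠ ⊤)
    (hGΛ : ∀ j, eLpNorm (Gs j) 2 (μ.restrict (Ω : Set E)) ≤ Λ) {K : Set E} (hK : IsCompact K)
    (hKΩ : K ⊆ (Ω : Set E)) {ε : ℝ≥0∞} (hε : 0 < ε) :
    ∃ s : Finset ℕ, ∀ j, ∃ m ∈ s, eLpNorm (fun x => u j x - u m x) 2 (μ.restrict K) < ε := by
  -- reduce to finite `ε`
  wlog hεt : ε ≠ ⊤ generalizing ε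
  · obtain ⟨s, hs⟩ := this one_pos ENNReal.one_ne_top
    refine ⟨s, fun n => (hs n).imp fun m hm => ⟨hm.1, hm.2.trans_le ?_⟩⟩
    rw [not_ne_iff.1 hεt]; exact le_top
  -- empty `K` is trivial
  by_cases hKe : K = ∅
  · refine ⟨{0}, fun j => ⟨0, Finset.mem_singleton_self 0, ?_⟩⟩
    rw [hKe, Measure.restrict_empty, eLpNorm_measure_zero]
    exact hε
  obtain ⟨x₀, hx₀⟩ := Set.nonempty_iff_ne_empty.2 hKe
  have hB0 : 0 ≤ B := (norm_nonneg _).trans (hB 0 x₀ (hKΩ hx₀))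
  -- `η := ε / 3`
  set η : ℝ≥0∞ := ε / 3 with hηdef
  have hη0 : η ≠ 0 := (ENNReal.div_pos hε.ne' (by norm_num)).ne'
  have hηt : η ≠ ⊤ := ENNReal.div_ne_top hεt (by norm_num)
  -- (1) cut-off and a compactly contained neighbourhood
  obtain ⟨χ, hχ, hχc, hχΩ, hχK⟩ := MeyersSerrin.exists_smooth_cutoff hK Ω.isOpen hKΩ
  have hχK' : ∀ x ∈ K, χ x = 1 := fun x hx => hχK.self_of_nhdsSet x hx
  obtain ⟨δ, hδ, hδΩ⟩ := hχc.exists_cthickening_subset_open Ω.isOpen hχΩ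
  set Ω' : Opens E := ⟨thickening δ (tsupport χ), isOpen_thickening⟩ with hΩ'def
  have hSΩ' : tsupport χ ⊆ (Ω' : Set E) := self_subset_thickening hδ _
  have hΩ'c : (Ω' : Set E) ⊆ cthickening δ (tsupport χ) := thickening_subset_cthickening δ _
  have hCc : IsCompact (cthickening δ (tsupport χ)) :=
    isCompact_of_isClosed_isBounded isClosed_cthickening hχc.isBounded.cthickening
  have hΩ'Ω : (Ω' : Set E) ⊆ (Ω : Set E) := hΩ'c.trans hδΩ
  have hΩ'le : Ω' ≤ Ω := hΩ'Ω
  have hΩ'm : MeasurableSet (Ω' : Set E) := Ω'.isOpen.measurableSet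
  have hΩ'fin : μ (Ω' : Set E) < ⊤ := (measure_mono hΩ'c).trans_lt hCc.measure_lt_top
  haveI : IsFiniteMeasure (μ.restrict (Ω' : Set E)) := isFiniteMeasure_restrict.2 hΩ'fin.ne
  have hKΩ' : K ⊆ (Ω' : Set E) := fun x hx =>
    hSΩ' (subset_tsupport _ (by rw [mem_support, hχK' x hx]; exact one_ne_zero))
  -- bounds for the cut-off and its gradient
  obtain ⟨Mχ, hMχ⟩ := hχc.exists_bound_of_continuous hχ.continuous
  obtain ⟨Mχ', hMχ'⟩ := (hχc.fderiv (𝕜 := ℝ)).exists_bound_of_continuous (hχ.continuous_fderiv (by simp))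
  have hMχ0 : 0 ≤ Mχ := (norm_nonneg _).trans (hMχ x₀)
  have hMχ'0 : 0 ≤ Mχ' := (norm_nonneg _).trans (hMχ' x₀)
  -- (2) `u_j ∈ W^{1,2}(Ω')`
  have hu' : ∀ j, HasWeakFDerivOn Ω' μ (u j) (Gs j) := fun j => HasWeakFDerivOn.mono_set_holds (hu j) hΩ'le
  have hum : ∀ j, AEStronglyMeasurable (u j) (μ.restrict (Ω' : Set E)) :=
    fun j => (hu' j).locallyIntegrableOn.aestronglyMeasurable
  have huB : ∀ j, ∀ᵐ x ∂(μ.restrict (Ω' : Set E)), ‖u j x‖ ≤ B := fun j => by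
    filter_upwards [ae_restrict_mem hΩ'm] with x hx
    exact hB j x (hΩ'Ω hx)
  have huL2 : ∀ j, MemLp (u j) 2 (μ.restrict (Ω' : Set E)) :=
    fun j => (memLp_top_of_bound (hum j) B (huB j)).mono_exponent le_top
  have hGm : ∀ j, AEStronglyMeasurable (Gs j) (μ.restrict (Ω' : Set E)) :=
    fun j => (hu' j).locallyIntegrableOn_deriv.aestronglyMeasurable
  have hGL2 : ∀ j, MemLp (Gs j) 2 (μ.restrict (Ω' : Set E)) := fun j =>
    ⟨hGm j, ((eLpNorm_mono_measure _ (Measure.restrict_mono hΩ'Ω le_rfl)).trans (hGΛ j)).trans_lt hΛ.lt_top⟩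
  have hmem : ∀ j, MemSobolevDomain 1 2 Ω' μ (u j) := by
    intro j
    rw [memSobolevDomain_succ_iff]
    refine ⟨huL2 j, Gs j, hu' j, fun v => ?_⟩
    rw [memSobolevDomain_zero_iff]
    exact (hGL2 j).of_le_mul (c := ‖v‖)
      ((ContinuousLinearMap.apply ℝ F v).continuous.comp_aestronglyMeasurable (hGm j))
      (Filter.Eventually.of_forall fun x => by rw [mul_comm]; exact (Gs j x).le_opNorm v)
  -- (3) Meyers–Serrin approximants within `η`
  choose v hv hvη using fun j => MeyersSerrin.exists_contDiffOn_eSobolevDomainNorm_sub_le (Ω := Ω') (μ := μ)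
    (p := 2) one_le_two ENNReal.ofNat_ne_top (hmem j) hη0
  have hvW : ∀ j, HasWeakFDerivOn Ω' μ (v j) (fderiv ℝ (v j)) :=
    fun j => MeyersSerrin.hasWeakFDerivOn_of_contDiffOn (μ := μ) (hv j)
  have hsub : ∀ j, HasWeakFDerivOn Ω' μ (u j - v j) (Gs j - fderiv ℝ (v j)) := fun j => (hu' j).sub (hvW j)
  have hvm : ∀ j, AEStronglyMeasurable (v j) (μ.restrict (Ω' : Set E)) :=
    fun j => (hv j).continuousOn.aestronglyMeasurable hΩ'm
  have hv'm : ∀ j, AEStronglyMeasurable (fderiv ℝ (v j)) (μ.restrict (Ω' : Set E)) :=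
    fun j => ((hv j).continuousOn_fderiv_of_isOpen Ω'.isOpen (by simp)).aestronglyMeasurable hΩ'm
  -- `L²` consequences of the Sobolev-norm bound
  have hL2uv : ∀ j, eLpNorm (fun x => u j x - v j x) 2 (μ.restrict (Ω' : Set E)) ≤ η :=
    fun j => eLpNorm_le_eSobolevDomainNorm.trans (hvη j)
  set b := Module.finBasis ℝ E with hbdef
  have hL2D : ∀ j i, eLpNorm (fun x => (Gs j x - fderiv ℝ (v j) x) (b i)) 2 (μ.restrict (Ω' : Set E)) ≤ η := by
    intro j i
    have h1 := hvη j
    rw [MeyersSerrin.eSobolevDomainNorm_succ_eq (hsub j)] at h1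
    refine le_trans ?_ (le_trans le_add_self h1)
    have := Finset.single_le_sum (f := fun i => eSobolevDomainNorm 0 2 Ω' μ (fun x => (Gs j - fderiv ℝ (v j)) x (b i)))
      (fun _ _ => bot_le) (Finset.mem_univ i)
    simpa only [eSobolevDomainNorm_zero, Pi.sub_apply] using this
  -- (4) the compactly supported smooth functions `w_j := χ • v_j`
  have hw1 : ∀ j, ContDiff ℝ 1 (fun x => χ x • v j x) :=
    fun j => contDiff_one_cutoff_smul Ω'.isOpen (hχ.of_le (by simp)) hSΩ' ((hv j).of_le (by simp))
  have hwS : ∀ j, tsupport (fun x => χ x • v j x) ⊆ tsupport χ := fun j => tsupport_smul_subset_left _ _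
  have hwsupp : ∀ j, support (fun x => χ x • v j x) ⊆ (Ω' : Set E) :=
    fun j => (subset_tsupport _).trans ((hwS j).trans hSΩ')
  -- `L²` bound on `w_j`
  set A : ℝ≥0∞ := ENNReal.ofReal Mχ * (μ (Ω' : Set E) ^ (2:ℝ≥0∞).toReal⁻¹ * ENNReal.ofReal B + η) with hAdef
  have hAt : A ≠ ⊤ := ENNReal.mul_ne_top ENNReal.ofReal_ne_top
    (ENNReal.add_ne_top.2 ⟨ENNReal.mul_ne_top (ENNReal.rpow_ne_top_of_nonneg (by positivity) hΩ'fin.ne)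
      ENNReal.ofReal_ne_top, hηt⟩)
  have hvL2 : ∀ j, eLpNorm (v j) 2 (μ.restrict (Ω' : Set E)) ≤ μ (Ω' : Set E) ^ (2:ℝ≥0∞).toReal⁻¹ * ENNReal.ofReal B + η := by
    intro j
    have h1 : eLpNorm (u j) 2 (μ.restrict (Ω' : Set E)) ≤ μ (Ω' : Set E) ^ (2:ℝ≥0∞).toReal⁻¹ * ENNReal.ofReal B := by
      have := eLpNorm_le_of_ae_bound (p := 2) (huB j)
      rwa [Measure.restrict_apply_univ] at this
    have h2 : eLpNorm (v j) 2 (μ.restrict (Ω' : Set E)) ≤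
        eLpNorm (u j) 2 (μ.restrict (Ω' : Set E)) + eLpNorm (fun x => u j x - v j x) 2 (μ.restrict (Ω' : Set E)) := by
      have := eLpNorm_sub_le (hum j) ((hum j).sub (hvm j)) (p := 2) one_le_two
      refine le_trans (le_of_eq ?_) this
      congr 1; funext x; simp
    exact h2.trans (add_le_add h1 (hL2uv j))
  have hwA : ∀ j, eLpNorm (fun x => χ x • v j x) 2 μ ≤ A := by
    intro j
    rw [← eLpNorm_restrict_eq_of_support_subset (hwsupp j)]
    have h1 : eLpNorm (fun x => χ x • v j x) 2 (μ.restrict (Ω' : Set E)) ≤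
        ENNReal.ofReal Mχ * eLpNorm (v j) 2 (μ.restrict (Ω' : Set E)) :=
      eLpNorm_le_mul_eLpNorm_of_ae_le_mul (Filter.Eventually.of_forall fun x => by
        rw [norm_smul]; exact mul_le_mul_of_nonneg_right (hMχ x) (norm_nonneg _)) 2
    exact h1.trans (mul_le_mul' le_rfl (hvL2 j))
  -- `L²` bound on `D w_j`
  set D : ℝ≥0∞ := ∑ i, ‖LinearMap.toContinuousLinearMap (b.coord i)‖ₑ * (‖b i‖ₑ * Λ + η) with hDdef
  have hDt : D ≠ ⊤ := by
    refine ENNReal.sum_ne_top.2 fun i _ => ENNReal.mul_ne_top enorm_ne_top ?_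
    exact ENNReal.add_ne_top.2 ⟨ENNReal.mul_ne_top enorm_ne_top hΛ, hηt⟩
  have hDv : ∀ j, eLpNorm (fderiv ℝ (v j)) 2 (μ.restrict (Ω' : Set E)) ≤ D := by
    intro j
    have hcomp : ∀ i, AEStronglyMeasurable (fun x => fderiv ℝ (v j) x (b i)) (μ.restrict (Ω' : Set E)) :=
      fun i => (ContinuousLinearMap.apply ℝ F (b i)).continuous.comp_aestronglyMeasurable (hv'm j)
    refine (eLpNorm_clm_le_sum_basis _ hcomp 2 one_le_two).trans (Finset.sum_le_sum fun i _ => ?_)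
    refine mul_le_mul' le_rfl ?_
    -- `‖∂_i v_j‖ ≤ ‖G_j b_i‖ + ‖(G_j - ∂v_j) b_i‖`
    have hGi : AEStronglyMeasurable (fun x => Gs j x (b i)) (μ.restrict (Ω' : Set E)) :=
      (ContinuousLinearMap.apply ℝ F (b i)).continuous.comp_aestronglyMeasurable (hGm j)
    have h1 : eLpNorm (fun x => fderiv ℝ (v j) x (b i)) 2 (μ.restrict (Ω' : Set E)) ≤
        eLpNorm (fun x => Gs j x (b i)) 2 (μ.restrict (Ω' : Set E)) +
          eLpNorm (fun x => (Gs j x - fderiv ℝ (v j) x) (b i)) 2 (μ.restrict (Ω' : Set E)) := by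
      have := eLpNorm_sub_le hGi (hGi.sub (hcomp i)) (p := 2) one_le_two
      refine le_trans (le_of_eq ?_) (this.trans (le_of_eq ?_))
      · congr 1; funext x; simp
      · congr 2
    have h2 : eLpNorm (fun x => Gs j x (b i)) 2 (μ.restrict (Ω' : Set E)) ≤ ‖b i‖ₑ * Λ := by
      have h3 : eLpNorm (fun x => Gs j x (b i)) 2 (μ.restrict (Ω' : Set E)) ≤
          ENNReal.ofReal ‖b i‖ * eLpNorm (Gs j) 2 (μ.restrict (Ω' : Set E)) :=
        eLpNorm_le_mul_eLpNorm_of_ae_le_mul (Filter.Eventually.of_forall fun x => by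
          rw [mul_comm]; exact (Gs j x).le_opNorm (b i)) 2
      rw [ofReal_norm] at h3
      exact h3.trans (mul_le_mul' le_rfl ((eLpNorm_mono_measure _ (Measure.restrict_mono hΩ'Ω le_rfl)).trans (hGΛ j)))
    exact h1.trans (add_le_add h2 (hL2D j i))
  set B' : ℝ≥0∞ := ENNReal.ofReal Mχ * D + ENNReal.ofReal Mχ' * (μ (Ω' : Set E) ^ (2:ℝ≥0∞).toReal⁻¹ * ENNReal.ofReal B + η)
    with hB'def
  have hB't : B' ≠ ⊤ := ENNReal.add_ne_top.2 ⟨ENNReal.mul_ne_top ENNReal.ofReal_ne_top hDt,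
    ENNReal.mul_ne_top ENNReal.ofReal_ne_top (ENNReal.add_ne_top.2
      ⟨ENNReal.mul_ne_top (ENNReal.rpow_ne_top_of_nonneg (by positivity) hΩ'fin.ne) ENNReal.ofReal_ne_top, hηt⟩)⟩
  have hwB : ∀ j, eLpNorm (fderiv ℝ (fun x => χ x • v j x)) 2 μ ≤ B' := by
    intro j
    -- the derivative vanishes off `tsupport χ ⊆ Ω'`
    have hsupp' : ∀ x ∉ (Ω' : Set E), fderiv ℝ (fun x => χ x • v j x) x = 0 := fun x hx =>
      fderiv_of_notMem_tsupport ℝ fun h => hx (hSΩ' (hwS j h))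
    -- pointwise product rule on `Ω'`
    have hpt : ∀ x ∈ (Ω' : Set E), ‖fderiv ℝ (fun x => χ x • v j x) x‖ ≤
        Mχ * ‖fderiv ℝ (v j) x‖ + Mχ' * ‖v j x‖ := by
      intro x hx
      have hχd : DifferentiableAt ℝ χ x := (hχ.differentiable (by simp)) x
      have hvd : DifferentiableAt ℝ (v j) x :=
        ((hv j).differentiableOn (by simp)).differentiableAt (Ω'.isOpen.mem_nhds hx)
      rw [fderiv_fun_smul hχd hvd]
      refine (norm_add_le _ _).trans (add_le_add ?_ ?_)
      · rw [norm_smul]; exact mul_le_mul_of_nonneg_right (hMχ x) (norm_nonneg _)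
      · refine (ContinuousLinearMap.opNorm_le_bound _ (by positivity) fun w => ?_)
        rw [ContinuousLinearMap.smulRight_apply, norm_smul, mul_assoc, mul_comm ‖v j x‖, ← mul_assoc]
        exact mul_le_mul_of_nonneg_right ((fderiv ℝ χ x).le_of_opNorm_le (hMχ' x) w) (norm_nonneg _)
    -- a real-valued majorant supported in `Ω'`
    have hmaj : ∀ x, ‖fderiv ℝ (fun x => χ x • v j x) x‖ ≤
        ‖(Ω' : Set E).indicator (fun x => Mχ * ‖fderiv ℝ (v j) x‖ + Mχ' * ‖v j x‖) x‖ := by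
      intro x
      by_cases hx : x ∈ (Ω' : Set E)
      · rw [Set.indicator_of_mem hx, Real.norm_eq_abs, abs_of_nonneg (by positivity)]
        exact hpt x hx
      · rw [hsupp' x hx, norm_zero]; exact norm_nonneg _
    refine (eLpNorm_mono hmaj).trans ?_
    rw [eLpNorm_indicator_eq_eLpNorm_restrict hΩ'm]
    have hm1 : AEStronglyMeasurable (fun x => Mχ * ‖fderiv ℝ (v j) x‖) (μ.restrict (Ω' : Set E)) :=
      (hv'm j).norm.const_mul _
    have hm2 : AEStronglyMeasurable (fun x => Mχ' * ‖v j x‖) (μ.restrict (Ω' : Set E)) := (hvm j).norm.const_mul _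
    refine (eLpNorm_add_le hm1 hm2 one_le_two).trans (add_le_add ?_ ?_)
    · have : (fun x => Mχ * ‖fderiv ℝ (v j) x‖) = Mχ • (fun x => ‖fderiv ℝ (v j) x‖) := by funext x; simp [smul_eq_mul]
      rw [this, eLpNorm_const_smul, eLpNorm_norm, Real.enorm_eq_ofReal hMχ0]
      exact mul_le_mul' le_rfl (hDv j)
    · have : (fun x => Mχ' * ‖v j x‖) = Mχ' • (fun x => ‖v j x‖) := by funext x; simp [smul_eq_mul]
      rw [this, eLpNorm_const_smul, eLpNorm_norm, Real.enorm_eq_ofReal hMχ'0]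
      exact mul_le_mul' le_rfl (hvL2 j)
  -- (5) the `C¹` Rellich net for `w_j`
  obtain ⟨s, hs⟩ := exists_finset_eLpNorm_sub_lt μ (p := 2) one_le_two hχc (fun j => fun x => χ x • v j x)
    hw1 hwS hAt hB't hwA hwB (pos_iff_ne_zero.2 hη0)
  refine ⟨s, fun j => ?_⟩
  obtain ⟨m, hm, hjm⟩ := hs j
  refine ⟨m, hm, ?_⟩
  -- (6) back to `u` on `K`
  have hKm : MeasurableSet K := hK.measurableSet
  have hresK : μ.restrict K ≤ μ.restrict (Ω' : Set E) := Measure.restrict_mono hKΩ' le_rfl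
  have humK : ∀ j, AEStronglyMeasurable (u j) (μ.restrict K) := fun j => (hum j).mono_measure hresK
  have hvmK : ∀ j, AEStronglyMeasurable (v j) (μ.restrict K) := fun j => (hvm j).mono_measure hresK
  have e1 : eLpNorm (fun x => u j x - v j x) 2 (μ.restrict K) ≤ η :=
    (eLpNorm_mono_measure _ hresK).trans (hL2uv j)
  have e3 : eLpNorm (fun x => v m x - u m x) 2 (μ.restrict K) ≤ η := by
    have := (eLpNorm_mono_measure (fun x => u m x - v m x) hresK).trans (hL2uv m)
    rwa [← eLpNorm_neg, show -(fun x => u m x - v m x) = fun x => v m x - u m x by funext x; simp] at this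
  have e2 : eLpNorm (fun x => v j x - v m x) 2 (μ.restrict K) < η := by
    have hK1 : eLpNorm (fun x => v j x - v m x) 2 (μ.restrict K) =
        eLpNorm (fun x => χ x • v j x - χ x • v m x) 2 (μ.restrict K) := by
      refine eLpNorm_congr_ae ?_
      filter_upwards [ae_restrict_mem hKm] with x hx
      rw [hχK' x hx, one_smul, one_smul]
    rw [hK1]
    refine lt_of_le_of_lt (eLpNorm_mono_measure _ Measure.restrict_le_self) ?_
    have : (fun x => χ x • v j x - χ x • v m x) = ((fun x => χ x • v j x) - fun x => χ x • v m x) := rfl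
    rw [this]; exact hjm
  have hsplit : (fun x => u j x - u m x) =
      fun x => ((u j x - v j x) + (v j x - v m x)) + (v m x - u m x) := by funext x; abel
  rw [hsplit]
  have m12 : AEStronglyMeasurable (fun x => (u j x - v j x) + (v j x - v m x)) (μ.restrict K) :=
    ((humK j).sub (hvmK j)).add ((hvmK j).sub (hvmK m))
  calc eLpNorm (fun x => ((u j x - v j x) + (v j x - v m x)) + (v m x - u m x)) 2 (μ.restrict K)
      ≤ eLpNorm (fun x => (u j x - v j x) + (v j x - v m x)) 2 (μ.restrict K) +
          eLpNorm (fun x => v m x - u m x) 2 (μ.restrict K) := eLpNorm_add_le m12 ((hvmK m).sub (humK m)) one_le_two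
    _ ≤ (eLpNorm (fun x => u j x - v j x) 2 (μ.restrict K) + eLpNorm (fun x => v j x - v m x) 2 (μ.restrict K)) +
          eLpNorm (fun x => v m x - u m x) 2 (μ.restrict K) :=
        add_le_add (eLpNorm_add_le ((humK j).sub (hvmK j)) ((hvmK j).sub (hvmK m)) one_le_two) le_rfl
    _ < (η + η) + η := by
        refine ENNReal.add_lt_add_of_lt_of_le (ne_top_of_le_ne_top hηt e3) ?_ e3
        exact ENNReal.add_lt_add_of_le_of_lt (ne_top_of_le_ne_top hηt e1) e1 e2
    _ = ε := by rw [hηdef, ENNReal.add_thirds]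

end Literature.Analysis.PDE.MinimisingMaps

end Part1

/-!
## Part 2 — port of `Summits/QuantumFields/YangMills/Theorems/PoincareLipschitzSobolevL2Compactness.lean` (2 declarations kept)

# Energy minimising maps into `S³` (Hardt–Kinderlehrer–Lin / Luckhaus / Simon §2.9): Sobolev L2 Compactness

Declarations of this Part (verbatim port; each keeps its own docstring and citation): `exists_finset_eLpNorm_sub_lt_of_weakGrad_of_measure_lt_top`, `exists_subseq_tendsto_eLpNorm_of_weakGrad`.

Reference keys (see `references.bib` and the declarations' citations): [Evans2010], [Adams1975], [Simon1996].
-/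

section Part2

open _root_.MeasureTheory _root_.Set _root_.Function _root_.Filter _root_.Topology _root_.Metric _root_.TopologicalSpace
open scoped _root_.ContDiff _root_.ENNReal

namespace Literature.Analysis.PDE.MinimisingMaps

open Literature.Analysis.FunctionSpaces

variable {E : Type*} [NormedAddCommGroup E] [NormedSpace ℝ E] [FiniteDimensional ℝ E]
  [MeasurableSpace E] [BorelSpace E] {μ : Measure E} [μ.IsAddHaarMeasure]
variable {F : Type*} [NormedAddCommGroup F] [NormedSpace ℝ F] [CompleteSpace F] [FiniteDimensional ℝ F]

/-! ## §1 Total boundedness in `L²(Ω)` -/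

/-- **GLOBAL `L²(Ω)` NETS** (`μ Ω < ∞`): nets on a large compact (C-a1) plus small tails. [cite: Evans2010, §5.7 Theorem 1] -/
theorem exists_finset_eLpNorm_sub_lt_of_weakGrad_of_measure_lt_top {Ω : Opens E} (hΩ : μ (Ω : Set E) < ⊤)
    {u : ℕ → E → F} {Gs : ℕ → E → E →L[ℝ] F} (hu : ∀ j, HasWeakFDerivOn Ω μ (u j) (Gs j)) {B : ℝ}
    (hB : ∀ j, ∀ x ∈ (Ω : Set E), ‖u j x‖ ≤ B) {Λ : ℝ≥0∞} (hΛ : Λ ≠ ⊤)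
    (hGΛ : ∀ j, eLpNorm (Gs j) 2 (μ.restrict (Ω : Set E)) ≤ Λ) {ε : ℝ≥0∞} (hε : 0 < ε) :
    ∃ s : Finset ℕ, ∀ j, ∃ m ∈ s, eLpNorm (fun x => u j x - u m x) 2 (μ.restrict (Ω : Set E)) < ε := by
  -- reduce to finite `ε`
  wlog hεt : ε ≠ ⊤ generalizing ε
  · obtain ⟨s, hs⟩ := this one_pos ENNReal.one_ne_top
    refine ⟨s, fun n => (hs n).imp fun m hm => ⟨hm.1, hm.2.trans_le ?_⟩⟩
    rw [not_ne_iff.1 hεt]; exact le_top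
  have hΩm : MeasurableSet (Ω : Set E) := Ω.isOpen.measurableSet
  -- empty `Ω` is trivial
  by_cases hΩe : (Ω : Set E) = ∅
  · refine ⟨{0}, fun j => ⟨0, Finset.mem_singleton_self 0, ?_⟩⟩
    rw [hΩe, Measure.restrict_empty, eLpNorm_measure_zero]
    exact hε
  obtain ⟨x₀, hx₀⟩ := Set.nonempty_iff_ne_empty.2 hΩe
  have hB0 : 0 ≤ B := (norm_nonneg _).trans (hB 0 x₀ hx₀)
  set η : ℝ≥0∞ := ε / 3 with hηdef
  have hη0 : 0 < η := ENNReal.div_pos hε.ne' (by norm_num)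
  have hηt : η ≠ ⊤ := ENNReal.div_ne_top hεt (by norm_num)
  -- (1) exhaustion and a compact `K` with small complement
  obtain ⟨V, hVmono, hVc, hVsucc, hVΩ, hΩV⟩ := MeyersSerrin.exists_exhaustion Ω
  have hUnion : (⋃ m, (V m : Set E)) = (Ω : Set E) :=
    Subset.antisymm (iUnion_subset fun m => hVΩ m) hΩV
  have hmono' : Monotone fun m => (V m : Set E) := fun a b hab => hVmono hab
  have htend : Tendsto (fun m => μ (V m : Set E)) atTop (𝓝 (μ (Ω : Set E))) := by
    have := tendsto_measure_iUnion_atTop (μ := μ) hmono'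
    rwa [hUnion] at this
  -- choose `m` with `μ (Ω \\ V m) < (η / (2B+1))²`-type smallness; we ask `(2B+1)² μ(Ω \\ V m) ≤ η²` via the tail bound below
  set τ : ℝ≥0∞ := (η / ENNReal.ofReal (2 * B + 1)) ^ 2 with hτdef
  have hτ0 : 0 < τ := ENNReal.pow_pos (ENNReal.div_pos hη0.ne' ENNReal.ofReal_ne_top) 2
  have hex : ∃ m, μ (Ω : Set E) < μ (V m : Set E) + τ := by
    have h1 : ∀ᶠ m in atTop, μ (Ω : Set E) < μ (V m : Set E) + τ := by
      have hlt : μ (Ω : Set E) < μ (Ω : Set E) + τ := ENNReal.lt_add_right hΩ.ne hτ0.ne'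
      exact (htend.add tendsto_const_nhds).eventually (lt_mem_nhds hlt) |>.mono fun m hm => hm
    exact h1.exists
  obtain ⟨m, hm⟩ := hex
  set K : Set E := closure (V m : Set E) with hKdef
  have hKc : IsCompact K := hVc m
  have hKΩ : K ⊆ (Ω : Set E) := (hVsucc m).trans (hVΩ (m + 1))
  have hKm : MeasurableSet K := isClosed_closure.measurableSet
  have hdiff : μ ((Ω : Set E) \ K) < τ := by
    have h1 : μ ((Ω : Set E) \ K) ≤ μ ((Ω : Set E) \ (V m : Set E)) := measure_mono (sdiff_subset_sdiff_right subset_closure)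
    refine h1.trans_lt ?_
    have h2 : μ ((Ω : Set E) \ (V m : Set E)) = μ (Ω : Set E) - μ (V m : Set E) :=
      measure_sdiff (hVΩ m) (V m).isOpen.measurableSet.nullMeasurableSet ((measure_mono (hVΩ m)).trans_lt hΩ).ne
    rw [h2]
    exact ENNReal.sub_lt_of_lt_add ((measure_mono (hVΩ m))) (by rwa [add_comm] at hm)
  -- (2) the net on `K`
  obtain ⟨s, hs⟩ := exists_finset_eLpNorm_sub_lt_of_weakGrad hu hB hΛ hGΛ hKc hKΩ hη0
  refine ⟨s, fun j => ?_⟩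
  obtain ⟨k, hk, hjk⟩ := hs j
  refine ⟨k, hk, ?_⟩
  -- (3) split `Ω = K ∪ (Ω \\ K)`
  have hsplit : (Ω : Set E) = K ∪ ((Ω : Set E) \ K) := (union_sdiff_cancel hKΩ).symm
  have hmeas : ∀ j, AEStronglyMeasurable (u j) (μ.restrict (Ω : Set E)) :=
    fun j => (hu j).locallyIntegrableOn.aestronglyMeasurable
  have htail : eLpNorm (fun x => u j x - u k x) 2 (μ.restrict ((Ω : Set E) \ K)) ≤ η := by
    have hbd : ∀ᵐ x ∂(μ.restrict ((Ω : Set E) \ K)), ‖u j x - u k x‖ ≤ 2 * B + 1 := by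
      filter_upwards [ae_restrict_mem (hΩm.diff hKm)] with x hx
      calc ‖u j x - u k x‖ ≤ ‖u j x‖ + ‖u k x‖ := norm_sub_le _ _
        _ ≤ B + B := add_le_add (hB j x hx.1) (hB k x hx.1)
        _ ≤ 2 * B + 1 := by linarith
    refine (eLpNorm_le_of_ae_bound hbd).trans ?_
    rw [Measure.restrict_apply_univ]
    have h2 : (2 : ℝ≥0∞).toReal⁻¹ = ((1 : ℝ) / 2) := by norm_num
    rw [h2]
    -- `μ(Ω \\ K)^{1/2} * (2B+1) ≤ τ^{1/2} (2B+1) = η`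
    have h3 : μ ((Ω : Set E) \ K) ^ ((1 : ℝ) / 2) ≤ τ ^ ((1 : ℝ) / 2) := ENNReal.rpow_le_rpow hdiff.le (by norm_num)
    have h4 : τ ^ ((1 : ℝ) / 2) = η / ENNReal.ofReal (2 * B + 1) := by
      rw [hτdef, ← ENNReal.rpow_natCast, ← ENNReal.rpow_mul]; norm_num
    have hpos : ENNReal.ofReal (2 * B + 1) ≠ 0 := by
      rw [ne_eq, ENNReal.ofReal_eq_zero, not_le]; linarith
    calc μ ((Ω : Set E) \ K) ^ ((1 : ℝ) / 2) * ENNReal.ofReal (2 * B + 1)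
        ≤ τ ^ ((1 : ℝ) / 2) * ENNReal.ofReal (2 * B + 1) := mul_le_mul' h3 le_rfl
      _ = η := by rw [h4, ENNReal.div_mul_cancel hpos ENNReal.ofReal_ne_top]
  have hunion : eLpNorm (fun x => u j x - u k x) 2 (μ.restrict (Ω : Set E)) ≤
      eLpNorm (fun x => u j x - u k x) 2 (μ.restrict K) + eLpNorm (fun x => u j x - u k x) 2 (μ.restrict ((Ω : Set E) \ K)) := by
    set f : E → F := fun x => u j x - u k x with hfdef
    have hfm : AEStronglyMeasurable f (μ.restrict (Ω : Set E)) := (hmeas j).sub (hmeas k)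
    have hdec : f =ᵐ[μ.restrict (Ω : Set E)] fun x => K.indicator f x + ((Ω : Set E) \ K).indicator f x := by
      filter_upwards [ae_restrict_mem hΩm] with x hx
      by_cases hxK : x ∈ K
      · rw [Set.indicator_of_mem hxK, Set.indicator_of_notMem (fun h => h.2 hxK), add_zero]
      · have hxD : x ∈ (Ω : Set E) \ K := ⟨hx, hxK⟩
        rw [Set.indicator_of_notMem hxK, Set.indicator_of_mem hxD, zero_add]
    rw [eLpNorm_congr_ae hdec]
    refine (eLpNorm_add_le (hfm.indicator hKm) (hfm.indicator (hΩm.diff hKm)) one_le_two).trans (le_of_eq ?_)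
    rw [eLpNorm_indicator_eq_eLpNorm_restrict hKm, eLpNorm_indicator_eq_eLpNorm_restrict (hΩm.diff hKm),
      Measure.restrict_restrict hKm, Measure.restrict_restrict (hΩm.diff hKm),
      Set.inter_eq_self_of_subset_left hKΩ, Set.inter_eq_self_of_subset_left sdiff_subset]
  refine hunion.trans_lt ?_
  calc eLpNorm (fun x => u j x - u k x) 2 (μ.restrict K) + eLpNorm (fun x => u j x - u k x) 2 (μ.restrict ((Ω : Set E) \ K))
      < η + η := ENNReal.add_lt_add_of_lt_of_le (ne_top_of_le_ne_top hηt htail) hjk htail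
    _ ≤ η + η + η := le_self_add
    _ = ε := by rw [hηdef, ENNReal.add_thirds]

/-! ## §2 The convergent subsequence -/

/-- **STRONG `L²(Ω)` COMPACTNESS FOR SEQUENCES BOUNDED IN `L^∞ ∩ W^{1,2}` ON A SET OF FINITE MEASURE** (interior
Rellich–Kondrachov, sequential form, plus an a.e.-convergent refinement): there are a subsequence `φ` and `U ∈ L²(Ω)`
with `‖u_{φ j} − U‖_{L²(Ω)} → 0` and `u_{φ j} → U` a.e. on `Ω`. [cite: Evans2010, §5.7 Theorem 1; Adams1975, Theorem 6.2] -/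
theorem exists_subseq_tendsto_eLpNorm_of_weakGrad {Ω : Opens E} (hΩ : μ (Ω : Set E) < ⊤)
    {u : ℕ → E → F} {Gs : ℕ → E → E →L[ℝ] F} (hu : ∀ j, HasWeakFDerivOn Ω μ (u j) (Gs j)) {B : ℝ}
    (hB : ∀ j, ∀ x ∈ (Ω : Set E), ‖u j x‖ ≤ B) {Λ : ℝ≥0∞} (hΛ : Λ ≠ ⊤)
    (hGΛ : ∀ j, eLpNorm (Gs j) 2 (μ.restrict (Ω : Set E)) ≤ Λ) :
    ∃ (U : E → F) (φ : ℕ → ℕ), StrictMono φ ∧ MemLp U 2 (μ.restrict (Ω : Set E)) ∧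
      Tendsto (fun j => eLpNorm (fun x => u (φ j) x - U x) 2 (μ.restrict (Ω : Set E))) atTop (𝓝 0) ∧
      ∀ᵐ x ∂(μ.restrict (Ω : Set E)), Tendsto (fun j => u (φ j) x) atTop (𝓝 (U x)) := by
  have hΩm : MeasurableSet (Ω : Set E) := Ω.isOpen.measurableSet
  haveI : IsFiniteMeasure (μ.restrict (Ω : Set E)) := isFiniteMeasure_restrict.2 hΩ.ne
  haveI : Fact (1 ≤ (2 : ℝ≥0∞)) := ⟨one_le_two⟩
  have hmeas : ∀ j, AEStronglyMeasurable (u j) (μ.restrict (Ω : Set E)) :=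
    fun j => (hu j).locallyIntegrableOn.aestronglyMeasurable
  have hmem : ∀ j, MemLp (u j) 2 (μ.restrict (Ω : Set E)) := fun j =>
    (memLp_top_of_bound (hmeas j) B (by filter_upwards [ae_restrict_mem hΩm] with x hx; exact hB j x hx)).mono_exponent
      le_top
  -- the sequence in `L²(Ω)` and its total boundedness
  let Φ : ℕ → Lp F 2 (μ.restrict (Ω : Set E)) := fun j => (hmem j).toLp (u j)
  have htb : TotallyBounded (range Φ) := by
    refine EMetric.totallyBounded_iff.2 fun ε hε => ?_
    obtain ⟨s, hs⟩ := exists_finset_eLpNorm_sub_lt_of_weakGrad_of_measure_lt_top hΩ hu hB hΛ hGΛ hε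
    refine ⟨Φ '' s, s.finite_toSet.image Φ, ?_⟩
    rintro _ ⟨n, rfl⟩
    obtain ⟨m, hm, hnm⟩ := hs n
    refine mem_iUnion₂.2 ⟨Φ m, mem_image_of_mem Φ hm, ?_⟩
    rw [Metric.mem_eball, Lp.edist_toLp_toLp]
    exact hnm
  have hcomp : IsCompact (closure (range Φ)) := htb.closure.isCompact_of_isClosed isClosed_closure
  obtain ⟨g, -, φ, hφ, hlim⟩ := hcomp.tendsto_subseq (x := Φ) fun n => subset_closure (mem_range_self n)
  -- `L²` convergence of the functions
  have hL2 : Tendsto (fun j => eLpNorm (fun x => u (φ j) x - (g : E → F) x) 2 (μ.restrict (Ω : Set E))) atTop (𝓝 0) := by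
    rw [tendsto_iff_edist_tendsto_0] at hlim
    refine hlim.congr fun n => ?_
    simp only [Function.comp_apply, Φ]
    rw [Lp.edist_def]
    exact eLpNorm_congr_ae (((hmem _).coeFn_toLp).sub EventuallyEq.rfl)
  -- an a.e.-convergent further subsequence
  have hinm : TendstoInMeasure (μ.restrict (Ω : Set E)) (fun j => u (φ j)) atTop (g : E → F) :=
    tendstoInMeasure_of_tendsto_eLpNorm two_ne_zero (fun j => hmeas (φ j)) (Lp.aestronglyMeasurable g) hL2
  obtain ⟨ψ, hψ, hae⟩ := hinm.exists_seq_tendsto_ae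
  refine ⟨(g : E → F), φ ∘ ψ, hφ.comp hψ, Lp.memLp g, hL2.comp hψ.tendsto_atTop, ?_⟩
  exact hae

end Literature.Analysis.PDE.MinimisingMaps

end Part2

/-!
## Part 3 — port of `Summits/QuantumFields/YangMills/Theorems/PoincareLipschitzBlowDownCells.lean` (1 declarations kept)

# Energy minimising maps into `S³` (Hardt–Kinderlehrer–Lin / Luckhaus / Simon §2.9): Blow Down Cells

Declarations of this Part (verbatim port; each keeps its own docstring and citation): `measurable_coord`.

Reference keys (see `references.bib` and the declarations' citations): [AlicandroCicalese2008].
-/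

section Part3

open scoped _root_.BigOperators _root_.ENNReal
open _root_.MeasureTheory _root_.Set _root_.Finset _root_.Filter _root_.Topology

namespace Literature.Analysis.PDE.MinimisingMaps

open Literature.MathematicalPhysics.QuantumFieldTheory.Balaban1983to89
open B4Eq19LatticeOperators (Zd box unitVec)

/-! ## §1 Measurability of the blow-down -/

/-- The coordinate map `x ↦ xᵢ` on `EuclideanSpace ℝ (Fin 3)` is measurable. [cite: Simon1996, §2.9 Lemma 1 (compactness of energy minimising maps; supporting lemma)] -/
theorem measurable_coord (i : Fin 3) : Measurable fun x : EuclideanSpace ℝ (Fin 3) => x i :=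
  (EuclideanSpace.proj i).continuous.measurable

end Literature.Analysis.PDE.MinimisingMaps

end Part3

/-!
## Part 4 — port of `Summits/QuantumFields/YangMills/Theorems/PoincareLipschitzSamplingCells.lean` (4 declarations kept)

# Energy minimising maps into `S³` (Hardt–Kinderlehrer–Lin / Luckhaus / Simon §2.9): Sampling Cells

Declarations of this Part (verbatim port; each keeps its own docstring and citation): `isOpen_absCube`, `absCube_subset_closedBall`, `isCompact_absCubeClosed`, `volume_real_absCube`.

Reference keys (see `references.bib` and the declarations' citations): [AlicandroCicalese2008].
-/

section Part4

open scoped _root_.BigOperators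
open _root_.MeasureTheory _root_.Set _root_.Finset _root_.Metric

namespace Literature.Analysis.PDE.MinimisingMaps

open Literature.MathematicalPhysics.QuantumFieldTheory.Balaban1983to89
open B4Eq19LatticeOperators (Zd box unitVec mem_box)

/-! ## §1 Cubes and grid cells in `ℝ³` -/

/-- The open sup-norm cube `{|xᵢ| < t}` is open. [cite: Simon1996, §2.9 Lemma 1 (compactness of energy minimising maps; supporting lemma)] -/
theorem isOpen_absCube (t : ℝ) : IsOpen {x : EuclideanSpace ℝ (Fin 3) | ∀ i : Fin 3, |x i| < t} := by
  have : {x : EuclideanSpace ℝ (Fin 3) | ∀ i : Fin 3, |x i| < t} = ⋂ i : Fin 3, {x | |x i| < t} := by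
    ext x; simp
  rw [this]
  exact isOpen_iInter_of_finite fun i =>
    isOpen_lt (continuous_abs.comp (EuclideanSpace.proj i).continuous) continuous_const

/-- The closed sup-norm cube `{|xᵢ| ≤ t}` lies in the Euclidean closed ball of radius `2t` (`t ≥ 0`). [cite: Simon1996, §2.9 Lemma 1 (compactness of energy minimising maps; supporting lemma)] -/
theorem absCube_subset_closedBall {t : ℝ} (ht : 0 ≤ t) :
    {x : EuclideanSpace ℝ (Fin 3) | ∀ i : Fin 3, |x i| ≤ t} ⊆ closedBall 0 (2 * t) := by
  intro x hx
  rw [mem_closedBall, dist_zero_right, EuclideanSpace.norm_eq]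
  have hsum : ∑ i : Fin 3, ‖x i‖ ^ 2 ≤ 3 * t ^ 2 := by
    calc ∑ i : Fin 3, ‖x i‖ ^ 2 ≤ ∑ _i : Fin 3, t ^ 2 := Finset.sum_le_sum fun i _ => by
            rw [Real.norm_eq_abs]; exact pow_le_pow_left₀ (abs_nonneg _) (hx i) 2
      _ = 3 * t ^ 2 := by simp
  calc √(∑ i : Fin 3, ‖x i‖ ^ 2) ≤ √(3 * t ^ 2) := Real.sqrt_le_sqrt hsum
    _ ≤ √((2 * t) ^ 2) := Real.sqrt_le_sqrt (by nlinarith)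
    _ = 2 * t := Real.sqrt_sq (by linarith)

/-- The closed sup-norm cube `{|xᵢ| ≤ t}` is compact. [cite: Simon1996, §2.9 Lemma 1 (compactness of energy minimising maps; supporting lemma)] -/
theorem isCompact_absCubeClosed {t : ℝ} (ht : 0 ≤ t) : IsCompact {x : EuclideanSpace ℝ (Fin 3) | ∀ i : Fin 3, |x i| ≤ t} := by
  refine (isCompact_closedBall (0 : EuclideanSpace ℝ (Fin 3)) (2 * t)).of_isClosed_subset ?_ (absCube_subset_closedBall ht)
  have : {x : EuclideanSpace ℝ (Fin 3) | ∀ i : Fin 3, |x i| ≤ t} = ⋂ i : Fin 3, {x | |x i| ≤ t} := by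
    ext x; simp
  rw [this]
  exact isClosed_iInter fun i => isClosed_le (continuous_abs.comp (EuclideanSpace.proj i).continuous) continuous_const

/-- Volume of the open sup-norm cube `{|xᵢ| < t}` of half-side `t ≥ 0`: `(2t)³` (as a real number). [cite: Simon1996, §2.9 Lemma 1 (compactness of energy minimising maps; supporting lemma)] -/
theorem volume_real_absCube {t : ℝ} (ht : 0 ≤ t) :
    (volume {x : EuclideanSpace ℝ (Fin 3) | ∀ i : Fin 3, |x i| < t}).toReal = 8 * t ^ 3 := by
  have h : {x : EuclideanSpace ℝ (Fin 3) | ∀ i : Fin 3, |x i| < t} =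
      (WithLp.ofLp : EuclideanSpace ℝ (Fin 3) → (Fin 3 → ℝ)) ⁻¹' (Set.pi univ fun _ => Ioo (-t) t) := by
    ext x; simp [Set.mem_pi, abs_lt]
  rw [h, (PiLp.volume_preserving_ofLp (Fin 3)).measure_preimage
    (MeasurableSet.univ_pi fun i => measurableSet_Ioo).nullMeasurableSet, Real.volume_pi_Ioo]
  simp only [Finset.prod_const, Finset.card_univ, Fintype.card_fin]
  rw [ENNReal.toReal_pow, ENNReal.toReal_ofReal (by linarith)]
  ring

/-! ## §2 A weighted square bound and the frozen-derivative mean value step -/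

end Literature.Analysis.PDE.MinimisingMaps

end Part4

/-!
## Part 5 — port of `Summits/QuantumFields/YangMills/Theorems/PoincareLipschitzBlowDownModulus.lean` (1 declarations kept)

# Energy minimising maps into `S³` (Hardt–Kinderlehrer–Lin / Luckhaus / Simon §2.9): Blow Down Modulus

Declarations of this Part (verbatim port; each keeps its own docstring and citation): `openCube_subset_halfOpenCube`.

Reference keys (see `references.bib` and the declarations' citations): [Adams1975], [AlicandroCicalese2008], [Giaquinta1984].
-/

section Part5

open scoped _root_.BigOperators _root_.ENNReal
open _root_.MeasureTheory _root_.Set _root_.Filter _root_.Topology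

namespace Literature.Analysis.PDE.MinimisingMaps

open Literature.MathematicalPhysics.QuantumFieldTheory.Balaban1983to89
open B4Eq19LatticeOperators (Zd box unitVec mem_box)

/-! ## §1 The cubes -/

/-- The open cube lies in the half-open cube. [cite: Simon1996, §2.9 Lemma 1 (compactness of energy minimising maps; supporting lemma)] -/
theorem openCube_subset_halfOpenCube : {x : EuclideanSpace ℝ (Fin 3) | ∀ i : Fin 3, |x i| < 1} ⊆ {x | ∀ i, -1 ≤ x i ∧ x i < 1} := by
  intro x hx i
  have := abs_lt.1 (hx i)
  exact ⟨this.1.le, this.2⟩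

end Literature.Analysis.PDE.MinimisingMaps

end Part5

/-!
## Part 6 — port of `Summits/QuantumFields/YangMills/Theorems/PoincareLipschitzBlowDownL2Compactness.lean` (2 declarations kept)

# Energy minimising maps into `S³` (Hardt–Kinderlehrer–Lin / Luckhaus / Simon §2.9): Blow Down L2 Compactness

Declarations of this Part (verbatim port; each keeps its own docstring and citation): `measurableSet_dyadicCube`, `dyadicCube_subset_halfOpenCube`.

Reference keys (see `references.bib` and the declarations' citations): [Adams1975], [AlicandroCicalese2008], [Giaquinta1984].
-/

section Part6

open scoped _root_.BigOperators _root_.ENNReal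
open _root_.MeasureTheory _root_.Set _root_.Filter _root_.Topology

namespace Literature.Analysis.PDE.MinimisingMaps

open Literature.MathematicalPhysics.QuantumFieldTheory.Balaban1983to89
open B4Eq19LatticeOperators (Zd box unitVec mem_box)

/-! ## §5 The assembly -/

/-- The v1 dyadic cube `Π_i [−1 + 2jᵢ∕2^m, −1 + 2(jᵢ+1)∕2^m)` is measurable. [cite: Simon1996, §2.9 Lemma 1 (compactness of energy minimising maps; supporting lemma)] -/
theorem measurableSet_dyadicCube (m : ℕ) (j : Fin 3 → Fin (2 ^ m)) :
    MeasurableSet {x : EuclideanSpace ℝ (Fin 3) |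
      ∀ i : Fin 3, (-1 : ℝ) + 2 * (j i : ℕ) / (2 : ℝ) ^ m ≤ x i ∧ x i < (-1 : ℝ) + 2 * ((j i : ℕ) + 1) / (2 : ℝ) ^ m} := by
  have : {x : EuclideanSpace ℝ (Fin 3) | ∀ i : Fin 3, (-1 : ℝ) + 2 * (j i : ℕ) / (2 : ℝ) ^ m ≤ x i ∧ x i < (-1 : ℝ) + 2 * ((j i : ℕ) + 1) / (2 : ℝ) ^ m}
      = ⋂ i : Fin 3, (fun x : EuclideanSpace ℝ (Fin 3) => x i) ⁻¹'
          Set.Ico ((-1 : ℝ) + 2 * (j i : ℕ) / (2 : ℝ) ^ m) ((-1 : ℝ) + 2 * ((j i : ℕ) + 1) / (2 : ℝ) ^ m) := by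
    ext x; simp [Set.mem_Ico]
  rw [this]
  exact MeasurableSet.iInter fun i => measurableSet_Ico.preimage (measurable_coord i)

/-- The v1 dyadic cube lies in the half-open cube. [cite: Simon1996, §2.9 Lemma 1 (compactness of energy minimising maps; supporting lemma)] -/
theorem dyadicCube_subset_halfOpenCube (m : ℕ) (j : Fin 3 → Fin (2 ^ m)) :
    {x : EuclideanSpace ℝ (Fin 3) | ∀ i : Fin 3, (-1 : ℝ) + 2 * (j i : ℕ) / (2 : ℝ) ^ m ≤ x i ∧ x i < (-1 : ℝ) + 2 * ((j i : ℕ) + 1) / (2 : ℝ) ^ m}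
      ⊆ {x | ∀ i, -1 ≤ x i ∧ x i < 1} := by
  intro x hx i
  have h2 : (0 : ℝ) < (2 : ℝ) ^ m := by positivity
  have hj0 : (0 : ℝ) ≤ (j i : ℕ) := Nat.cast_nonneg _
  have hj1 : ((j i : ℕ) : ℝ) + 1 ≤ (2 : ℝ) ^ m := by
    have : (j i : ℕ) + 1 ≤ 2 ^ m := (j i).isLt
    exact_mod_cast this
  obtain ⟨hlo, hhi⟩ := hx i
  constructor
  · have : 0 ≤ 2 * ((j i : ℕ) : ℝ) / (2 : ℝ) ^ m := by positivity
    linarith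
  · have : 2 * (((j i : ℕ) : ℝ) + 1) / (2 : ℝ) ^ m ≤ 2 := by
      rw [div_le_iff₀ h2]; nlinarith
    linarith

end Literature.Analysis.PDE.MinimisingMaps

end Part6

/-!
## Part 7 — port of `Summits/QuantumFields/YangMills/Theorems/PoincareLipschitzDyadicMeansWeakLimit.lean` (13 declarations kept)

# Energy minimising maps into `S³` (Hardt–Kinderlehrer–Lin / Luckhaus / Simon §2.9): Dyadic Means Weak Limit

Declarations of this Part (verbatim port; each keeps its own docstring and citation): `volume_iUnion_lowerFaces_eq_zero`, `volume_halfOpenCube_diff_openCube`, `restrict_halfOpenCube_eq_restrict_openCube`, `restrict_openCube_restrict_dyadicCell`, `volume_openCube_lt_top`, `exists_mem_dyadicCell`, `dyadicCell_index_unique`, `norm_Lp_two_sq`, `norm_toLp_two_sq`, `inner_toLp_toLp`, `inner_toLp_left`, `inner_indicatorConstLp_toLp`, `exists_weakLimit_of_setIntegral_tendsto`.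
-/

section Part7

open _root_.MeasureTheory _root_.Filter _root_.Topology _root_.Set
open scoped RealInnerProductSpace _root_.ENNReal _root_.BigOperators

namespace Literature.Analysis.PDE.MinimisingMaps

/-! ## §1 Cube and dyadic-cell letters -/

/-- The three lower faces `{xᵢ = -1}` of the cube are Lebesgue-null in `ℝ³` (product structure of
Lebesgue measure, `Measure.pi_hyperplane`). [cite: Simon1996, §2.9 Lemma 1 (compactness of energy minimising maps; supporting lemma)] -/
theorem volume_iUnion_lowerFaces_eq_zero :
    volume (⋃ i : Fin 3, {x : EuclideanSpace ℝ (Fin 3) | x i = (-1 : ℝ)}) = 0 := by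
  refine measure_iUnion_null fun i => ?_
  have h : {x : EuclideanSpace ℝ (Fin 3) | x i = (-1 : ℝ)} =
      (WithLp.ofLp : EuclideanSpace ℝ (Fin 3) → (Fin 3 → ℝ)) ⁻¹' {f | f i = (-1 : ℝ)} := by
    ext x; simp
  have hmeas : MeasurableSet {f : Fin 3 → ℝ | f i = (-1 : ℝ)} :=
    measurableSet_eq_fun (measurable_pi_apply i) measurable_const
  rw [h, (PiLp.volume_preserving_ofLp (Fin 3)).measure_preimage hmeas.nullMeasurableSet,
    volume_pi]
  exact Measure.pi_hyperplane (fun _ : Fin 3 => (volume : Measure ℝ)) i (-1)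

/-- The half-open cube and the open cube differ by a Lebesgue-null set (three faces). [cite: Simon1996, §2.9 Lemma 1 (compactness of energy minimising maps; supporting lemma)] -/
theorem volume_halfOpenCube_diff_openCube :
    volume ({x : EuclideanSpace ℝ (Fin 3) | ∀ i : Fin 3, (-1 : ℝ) ≤ x i ∧ x i < 1} \
      {x : EuclideanSpace ℝ (Fin 3) | ∀ i : Fin 3, |x i| < 1}) = 0 := by
  refine measure_mono_null (fun x hx => ?_) volume_iUnion_lowerFaces_eq_zero
  obtain ⟨hC, hQ⟩ := hx
  simp only [mem_setOf_eq, not_forall, not_lt] at hQ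
  obtain ⟨i, hi⟩ := hQ
  refine mem_iUnion.2 ⟨i, ?_⟩
  obtain ⟨h1, h2⟩ := hC i
  have : x i ≤ -1 := by
    rcases le_abs.1 hi with h | h <;> linarith
  exact le_antisymm this h1

/-- `volume.restrict [-1,1)³ = volume.restrict Q`: the two cubes carry the same restricted Lebesgue
measure. [cite: Simon1996, §2.9 Lemma 1 (compactness of energy minimising maps; supporting lemma)] -/
theorem restrict_halfOpenCube_eq_restrict_openCube :
    volume.restrict {x : EuclideanSpace ℝ (Fin 3) | ∀ i : Fin 3, (-1 : ℝ) ≤ x i ∧ x i < 1} =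
      volume.restrict {x : EuclideanSpace ℝ (Fin 3) | ∀ i : Fin 3, |x i| < 1} := by
  refine Measure.restrict_congr_set ?_
  refine (ae_eq_set).2 ⟨volume_halfOpenCube_diff_openCube, ?_⟩
  rw [Set.sdiff_eq_empty.2 openCube_subset_halfOpenCube, measure_empty]

/-- On a dyadic cell, restricting first to `Q` changes nothing:
`(volume.restrict Q).restrict D_{m,j} = volume.restrict D_{m,j}`. [cite: Simon1996, §2.9 Lemma 1 (compactness of energy minimising maps; supporting lemma)] -/
theorem restrict_openCube_restrict_dyadicCell (m : ℕ) (j : Fin 3 → Fin (2 ^ m)) :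
    (volume.restrict {x : EuclideanSpace ℝ (Fin 3) | ∀ i : Fin 3, |x i| < 1}).restrict
      {x : EuclideanSpace ℝ (Fin 3) | ∀ i : Fin 3,
        (-1 : ℝ) + 2 * (j i : ℕ) / (2 : ℝ) ^ m ≤ x i ∧ x i < (-1 : ℝ) + 2 * ((j i : ℕ) + 1) / (2 : ℝ) ^ m} =
    volume.restrict {x : EuclideanSpace ℝ (Fin 3) | ∀ i : Fin 3,
        (-1 : ℝ) + 2 * (j i : ℕ) / (2 : ℝ) ^ m ≤ x i ∧ x i < (-1 : ℝ) + 2 * ((j i : ℕ) + 1) / (2 : ℝ) ^ m} := by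
  rw [← restrict_halfOpenCube_eq_restrict_openCube,
    Measure.restrict_restrict (measurableSet_dyadicCube m j),
    inter_eq_self_of_subset_left (dyadicCube_subset_halfOpenCube m j)]

/-- The open cube has finite volume (`= 8`). [cite: Simon1996, §2.9 Lemma 1 (compactness of energy minimising maps; supporting lemma)] -/
theorem volume_openCube_lt_top :
    volume {x : EuclideanSpace ℝ (Fin 3) | ∀ i : Fin 3, |x i| < 1} < ∞ := by
  have h8 : (volume {x : EuclideanSpace ℝ (Fin 3) | ∀ i : Fin 3, |x i| < 1}).toReal = 8 * 1 ^ 3 :=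
    volume_real_absCube zero_le_one
  by_contra htop
  rw [not_lt, top_le_iff] at htop
  rw [htop, ENNReal.toReal_top] at h8
  norm_num at h8

/-- The index of the dyadic cell of level `m` containing a point of the half-open cube. [cite: Simon1996, §2.9 Lemma 1 (compactness of energy minimising maps; supporting lemma)] -/
theorem exists_mem_dyadicCell (m : ℕ) {x : EuclideanSpace ℝ (Fin 3)}
    (hx : ∀ i : Fin 3, (-1 : ℝ) ≤ x i ∧ x i < 1) :
    ∃ j : Fin 3 → Fin (2 ^ m), ∀ i : Fin 3,
      (-1 : ℝ) + 2 * (j i : ℕ) / (2 : ℝ) ^ m ≤ x i ∧ x i < (-1 : ℝ) + 2 * ((j i : ℕ) + 1) / (2 : ℝ) ^ m := by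
  have hpow : (0 : ℝ) < (2 : ℝ) ^ m := by positivity
  -- `t i := (x i + 1) * 2^m / 2 ∈ [0, 2^m)`
  have ht : ∀ i, 0 ≤ (x i + 1) * (2 : ℝ) ^ m / 2 ∧ (x i + 1) * (2 : ℝ) ^ m / 2 < (2 : ℝ) ^ m := by
    intro i
    obtain ⟨h1, h2⟩ := hx i
    constructor
    · have : 0 ≤ x i + 1 := by linarith
      positivity
    · have : (x i + 1) / 2 < 1 := by linarith
      calc (x i + 1) * (2 : ℝ) ^ m / 2 = ((x i + 1) / 2) * (2 : ℝ) ^ m := by ring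
        _ < 1 * (2 : ℝ) ^ m := mul_lt_mul_of_pos_right this hpow
        _ = (2 : ℝ) ^ m := one_mul _
  have hfl : ∀ i, ⌊(x i + 1) * (2 : ℝ) ^ m / 2⌋.toNat < 2 ^ m := by
    intro i
    have h0 : 0 ≤ ⌊(x i + 1) * (2 : ℝ) ^ m / 2⌋ := Int.floor_nonneg.2 (ht i).1
    have h1 : ⌊(x i + 1) * (2 : ℝ) ^ m / 2⌋ < (2 : ℤ) ^ m := by
      have := (ht i).2
      have h' : ((⌊(x i + 1) * (2 : ℝ) ^ m / 2⌋ : ℤ) : ℝ) < (2 : ℝ) ^ m :=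
        lt_of_le_of_lt (Int.floor_le _) this
      exact_mod_cast h'
    have h2 : (⌊(x i + 1) * (2 : ℝ) ^ m / 2⌋.toNat : ℤ) < (2 : ℤ) ^ m := by
      rwa [Int.toNat_of_nonneg h0]
    exact_mod_cast h2
  refine ⟨fun i => ⟨⌊(x i + 1) * (2 : ℝ) ^ m / 2⌋.toNat, hfl i⟩, fun i => ?_⟩
  have h0 : 0 ≤ ⌊(x i + 1) * (2 : ℝ) ^ m / 2⌋ := Int.floor_nonneg.2 (ht i).1
  have hcast : (((⌊(x i + 1) * (2 : ℝ) ^ m / 2⌋.toNat : ℕ) : ℝ)) =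
      ((⌊(x i + 1) * (2 : ℝ) ^ m / 2⌋ : ℤ) : ℝ) := by
    have : ((⌊(x i + 1) * (2 : ℝ) ^ m / 2⌋.toNat : ℤ)) = ⌊(x i + 1) * (2 : ℝ) ^ m / 2⌋ :=
      Int.toNat_of_nonneg h0
    exact_mod_cast this
  dsimp only
  rw [hcast]
  have hle := Int.floor_le ((x i + 1) * (2 : ℝ) ^ m / 2)
  have hlt := Int.lt_floor_add_one ((x i + 1) * (2 : ℝ) ^ m / 2)
  constructor
  · -- `-1 + 2 ⌊t⌋ / 2^m ≤ x i`
    have : 2 * ((⌊(x i + 1) * (2 : ℝ) ^ m / 2⌋ : ℤ) : ℝ) / (2 : ℝ) ^ m ≤ x i + 1 := by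
      rw [div_le_iff₀ hpow]; linarith
    linarith
  · have : x i + 1 < 2 * (((⌊(x i + 1) * (2 : ℝ) ^ m / 2⌋ : ℤ) : ℝ) + 1) / (2 : ℝ) ^ m := by
      rw [lt_div_iff₀ hpow]; linarith
    linarith

/-- Two dyadic cells of the same level containing a common point coincide (index uniqueness).
[cite: Simon1996, §2.9 Lemma 1 (compactness of energy minimising maps; supporting lemma)] -/
theorem dyadicCell_index_unique (m : ℕ) {x : EuclideanSpace ℝ (Fin 3)} {j j' : Fin 3 → Fin (2 ^ m)}
    (hj : ∀ i : Fin 3,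
      (-1 : ℝ) + 2 * (j i : ℕ) / (2 : ℝ) ^ m ≤ x i ∧ x i < (-1 : ℝ) + 2 * ((j i : ℕ) + 1) / (2 : ℝ) ^ m)
    (hj' : ∀ i : Fin 3,
      (-1 : ℝ) + 2 * (j' i : ℕ) / (2 : ℝ) ^ m ≤ x i ∧ x i < (-1 : ℝ) + 2 * ((j' i : ℕ) + 1) / (2 : ℝ) ^ m) :
    j = j' := by
  have hpow : (0 : ℝ) < (2 : ℝ) ^ m := by positivity
  funext i
  apply Fin.ext
  obtain ⟨h1, h2⟩ := hj i
  obtain ⟨h1', h2'⟩ := hj' i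
  -- `j i < j' i + 1` and `j' i < j i + 1` as naturals
  have a1 : 2 * ((j i : ℕ) : ℝ) / (2 : ℝ) ^ m < 2 * (((j' i : ℕ) : ℝ) + 1) / (2 : ℝ) ^ m := by linarith
  have a2 : 2 * ((j' i : ℕ) : ℝ) / (2 : ℝ) ^ m < 2 * (((j i : ℕ) : ℝ) + 1) / (2 : ℝ) ^ m := by linarith
  rw [div_lt_div_iff_of_pos_right hpow] at a1 a2
  have b1 : ((j i : ℕ) : ℝ) < ((j' i : ℕ) : ℝ) + 1 := by linarith
  have b2 : ((j' i : ℕ) : ℝ) < ((j i : ℕ) : ℝ) + 1 := by linarith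
  have c1 : (j i : ℕ) < (j' i : ℕ) + 1 := by exact_mod_cast b1
  have c2 : (j' i : ℕ) < (j i : ℕ) + 1 := by exact_mod_cast b2
  omega

/-! ## §2 The general `L²` step: weak limit from convergent set integrals on a family with dense span -/

section General

variable {X : Type*} [MeasurableSpace X] {μ : Measure X}
variable {F : Type*} [NormedAddCommGroup F] [InnerProductSpace ℝ F]

/-- `‖f‖² = ∫ ‖f x‖²` for `f ∈ L²`. [cite: Simon1996, §2.9 Lemma 1 (compactness of energy minimising maps; supporting lemma)] -/
theorem norm_Lp_two_sq (f : Lp F 2 μ) : ‖f‖ ^ 2 = ∫ x, ‖f x‖ ^ 2 ∂μ := by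
  rw [← real_inner_self_eq_norm_sq, MeasureTheory.L2.inner_def]
  refine integral_congr_ae (Eventually.of_forall fun x => ?_)
  exact real_inner_self_eq_norm_sq (f x)

/-- `‖toLp f‖² = ∫ ‖f x‖²` for `f` in `ℒ²`. [cite: Simon1996, §2.9 Lemma 1 (compactness of energy minimising maps; supporting lemma)] -/
theorem norm_toLp_two_sq {f : X → F} (hf : MemLp f 2 μ) :
    ‖hf.toLp f‖ ^ 2 = ∫ x, ‖f x‖ ^ 2 ∂μ := by
  rw [norm_Lp_two_sq]
  refine integral_congr_ae ?_
  filter_upwards [hf.coeFn_toLp] with x hx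
  rw [hx]

/-- `⟪toLp f, toLp g⟫ = ∫ ⟪f x, g x⟫`. [cite: Simon1996, §2.9 Lemma 1 (compactness of energy minimising maps; supporting lemma)] -/
theorem inner_toLp_toLp {f g : X → F} (hf : MemLp f 2 μ) (hg : MemLp g 2 μ) :
    ⟪hf.toLp f, hg.toLp g⟫ = ∫ x, ⟪f x, g x⟫ ∂μ := by
  rw [MeasureTheory.L2.inner_def]
  refine integral_congr_ae ?_
  filter_upwards [hf.coeFn_toLp, hg.coeFn_toLp] with x hx hy
  rw [hx, hy]

/-- `⟪toLp g, f⟫ = ∫ ⟪g x, f x⟫` for `f ∈ L²`, `g ∈ ℒ²`. [cite: Simon1996, §2.9 Lemma 1 (compactness of energy minimising maps; supporting lemma)] -/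
theorem inner_toLp_left {g : X → F} (hg : MemLp g 2 μ) (f : Lp F 2 μ) :
    ⟪hg.toLp g, f⟫ = ∫ x, ⟪g x, f x⟫ ∂μ := by
  rw [MeasureTheory.L2.inner_def]
  refine integral_congr_ae ?_
  filter_upwards [hg.coeFn_toLp] with x hx
  rw [hx]

variable [CompleteSpace F]

/-- `⟪𝟙_s c, toLp f⟫ = ⟪c, ∫_s f⟫`. [cite: Simon1996, §2.9 Lemma 1 (compactness of energy minimising maps; supporting lemma)] -/
theorem inner_indicatorConstLp_toLp {s : Set X} (hs : MeasurableSet s) (hμs : μ s ≠ ∞) (c : F)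
    {f : X → F} (hf : MemLp f 2 μ) :
    ⟪indicatorConstLp 2 hs hμs c, hf.toLp f⟫ = ⟪c, ∫ x in s, f x ∂μ⟫ := by
  rw [MeasureTheory.L2.inner_indicatorConstLp_eq_inner_setIntegral]
  congr 1
  refine setIntegral_congr_ae hs ?_
  filter_upwards [hf.coeFn_toLp] with x hx _ using hx

/-- **Weak `L²` limit from convergent set integrals.**  Let `D i` (`i : ι`) be measurable sets of
finite `μ`-measure whose indicator functions times constant vectors have DENSE SPAN in `L²(μ; F)`.
If `v k ∈ ℒ²` with `∫ ‖v k‖² ≤ Λ` and every set integral `∫_{D i} v k` converges, then there is ONE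
`G ∈ ℒ²` with `∫ ‖G‖² ≤ Λ` such that, along the WHOLE sequence, `∫_{D i} v k → ∫_{D i} G` for every
`i` and `∫ ⟪ψ, v k⟫ → ∫ ⟪ψ, G⟫` for every `ψ ∈ ℒ²`.
[folklore; Leray 1934 §28 via `Literature.Analysis.FunctionSpaces.exists_mem_tendsto_inner_of_subset_closure_span`]
[cite: Simon1996, §2.9 Lemma 1 (compactness of energy minimising maps; supporting lemma)] -/
theorem exists_weakLimit_of_setIntegral_tendsto {ι : Type*} (D : ι → Set X)
    (hDm : ∀ i, MeasurableSet (D i)) (hDμ : ∀ i, μ (D i) ≠ ∞)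
    (hdense : Dense (Submodule.span ℝ
      {f : Lp F 2 μ | ∃ (i : ι) (c : F), f = indicatorConstLp 2 (hDm i) (hDμ i) c} : Set (Lp F 2 μ)))
    (v : ℕ → X → F) (hv : ∀ k, MemLp (v k) 2 μ) (Λ : ℝ) (hΛ : ∀ k, ∫ x, ‖v k x‖ ^ 2 ∂μ ≤ Λ)
    (hmean : ∀ i, ∃ g : F, Tendsto (fun k => ∫ x in D i, v k x ∂μ) atTop (𝓝 g)) :
    ∃ G : X → F, MemLp G 2 μ ∧ ∫ x, ‖G x‖ ^ 2 ∂μ ≤ Λ ∧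
      (∀ i, Tendsto (fun k => ∫ x in D i, v k x ∂μ) atTop (𝓝 (∫ x in D i, G x ∂μ))) ∧
      ∀ ψ : X → F, MemLp ψ 2 μ →
        Tendsto (fun k => ∫ x, ⟪ψ x, v k x⟫ ∂μ) atTop (𝓝 (∫ x, ⟪ψ x, G x⟫ ∂μ)) := by
  have hΛ0 : 0 ≤ Λ := le_trans (integral_nonneg fun x => sq_nonneg _) (hΛ 0)
  have hVnorm : ∀ k, ‖(hv k).toLp (v k)‖ ≤ Real.sqrt Λ := fun k => by
    rw [← Real.sqrt_sq (norm_nonneg ((hv k).toLp (v k)))]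
    exact Real.sqrt_le_sqrt (by rw [norm_toLp_two_sq]; exact hΛ k)
  -- the pairing with a cell indicator is the (inner product with the) cell integral
  have hpair : ∀ (i : ι) (c : F) (k : ℕ),
      ⟪(hv k).toLp (v k), indicatorConstLp 2 (hDm i) (hDμ i) c⟫ = ⟪c, ∫ x in D i, v k x ∂μ⟫ :=
    fun i c k => by rw [real_inner_comm, inner_indicatorConstLp_toLp]
  have hpair_tendsto : ∀ (i : ι) (c : F) (g : F),
      Tendsto (fun k => ∫ x in D i, v k x ∂μ) atTop (𝓝 g) →
      Tendsto (fun k => ⟪(hv k).toLp (v k), indicatorConstLp 2 (hDm i) (hDμ i) c⟫) atTop (𝓝 ⟪c, g⟫) :=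
    fun i c g hg => by
      simp_rw [hpair]
      exact tendsto_const_nhds.inner hg
  have hconv : ∀ d ∈ {f : Lp F 2 μ | ∃ (i : ι) (c : F), f = indicatorConstLp 2 (hDm i) (hDμ i) c},
      ∃ l : ℝ, Tendsto (fun k => ⟪(hv k).toLp (v k), d⟫) atTop (𝓝 l) := by
    rintro d ⟨i, c, rfl⟩
    obtain ⟨g, hg⟩ := hmean i
    exact ⟨⟪c, g⟫, hpair_tendsto i c g hg⟩
  have htop_closed : IsClosed ((⊤ : Submodule ℝ (Lp F 2 μ)) : Set (Lp F 2 μ)) := by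
    rw [Submodule.top_coe]; exact isClosed_univ
  have htop_sub : ((⊤ : Submodule ℝ (Lp F 2 μ)) : Set (Lp F 2 μ)) ⊆ closure (Submodule.span ℝ
      {f : Lp F 2 μ | ∃ (i : ι) (c : F), f = indicatorConstLp 2 (hDm i) (hDμ i) c} : Set (Lp F 2 μ)) := by
    rw [hdense.closure_eq]; exact subset_univ _
  obtain ⟨w, -, hwM, hw⟩ :=
    Literature.Analysis.FunctionSpaces.exists_mem_tendsto_inner_of_subset_closure_span
      (⊤ : Submodule ℝ (Lp F 2 μ)) htop_closed htop_sub (v := fun k => (hv k).toLp (v k))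
      (fun _ => Submodule.mem_top) hVnorm hconv
  refine ⟨w, Lp.memLp w, ?_, ?_, ?_⟩
  · rw [← norm_Lp_two_sq]
    calc ‖w‖ ^ 2 ≤ (Real.sqrt Λ) ^ 2 := pow_le_pow_left₀ (norm_nonneg _) hwM 2
      _ = Λ := Real.sq_sqrt hΛ0
  · intro i
    obtain ⟨g, hg⟩ := hmean i
    have hgi : ∫ x in D i, (w : X → F) x ∂μ = g := by
      apply ext_inner_left ℝ
      intro c
      have h1 := hw (indicatorConstLp 2 (hDm i) (hDμ i) c)
      have h2 := hpair_tendsto i c g hg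
      have h3 := tendsto_nhds_unique h1 h2
      rwa [real_inner_comm, MeasureTheory.L2.inner_indicatorConstLp_eq_inner_setIntegral] at h3
    rw [hgi]
    exact hg
  · intro ψ hψ
    have h1 := hw (hψ.toLp ψ)
    have e1 : ∀ k, ⟪(hv k).toLp (v k), hψ.toLp ψ⟫ = ∫ x, ⟪ψ x, v k x⟫ ∂μ := fun k => by
      rw [real_inner_comm, inner_toLp_toLp]
    have e2 : ⟪w, hψ.toLp ψ⟫ = ∫ x, ⟪ψ x, (w : X → F) x⟫ ∂μ := by
      rw [real_inner_comm, inner_toLp_left]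
    simp_rw [e1, e2] at h1
    exact h1

end General

end Literature.Analysis.PDE.MinimisingMaps

end Part7

/-!
## Part 8 — port of `Summits/QuantumFields/YangMills/Theorems/PoincareLipschitzDyadicMeansWeakLimitCube.lean` (4 declarations kept)

# Energy minimising maps into `S³` (Hardt–Kinderlehrer–Lin / Luckhaus / Simon §2.9): Dyadic Means Weak Limit Cube

Declarations of this Part (verbatim port; each keeps its own docstring and citation): `measure_dyadicCell_ne_top`, `dist_lowerCorner_le`, `dense_span_indicatorConstLp_dyadicCell`, `exists_weakLimit_of_dyadicMeans`.
-/

section Part8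

open _root_.MeasureTheory _root_.Filter _root_.Topology _root_.Set
open scoped RealInnerProductSpace _root_.ENNReal _root_.BigOperators

namespace Literature.Analysis.PDE.MinimisingMaps

/-! ## §1 Density of dyadic step functions in `L²(Q; F)` -/

section Density

variable {F : Type*} [NormedAddCommGroup F] [InnerProductSpace ℝ F]

/-- The dyadic cells have finite `volume.restrict Q`-measure. [cite: Simon1996, §2.9 Lemma 1 (compactness of energy minimising maps; supporting lemma)] -/
theorem measure_dyadicCell_ne_top (m : ℕ) (j : Fin 3 → Fin (2 ^ m)) :
    (volume.restrict {x : EuclideanSpace ℝ (Fin 3) | ∀ i : Fin 3, |x i| < 1})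
      {x : EuclideanSpace ℝ (Fin 3) | ∀ i : Fin 3,
        (-1 : ℝ) + 2 * (j i : ℕ) / (2 : ℝ) ^ m ≤ x i ∧ x i < (-1 : ℝ) + 2 * ((j i : ℕ) + 1) / (2 : ℝ) ^ m} ≠ ∞ := by
  refine ((measure_mono (subset_univ _)).trans_lt ?_).ne
  rw [Measure.restrict_apply_univ]
  exact volume_openCube_lt_top

/-- A point of the cell `D_{m,j}` is within `4/2^m` of the cell's lower corner. [cite: Simon1996, §2.9 Lemma 1 (compactness of energy minimising maps; supporting lemma)] -/
theorem dist_lowerCorner_le (m : ℕ) (j : Fin 3 → Fin (2 ^ m)) {x : EuclideanSpace ℝ (Fin 3)}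
    (hx : ∀ i : Fin 3,
      (-1 : ℝ) + 2 * (j i : ℕ) / (2 : ℝ) ^ m ≤ x i ∧ x i < (-1 : ℝ) + 2 * ((j i : ℕ) + 1) / (2 : ℝ) ^ m) :
    dist x (WithLp.toLp 2 (fun i => (-1 : ℝ) + 2 * (j i : ℕ) / (2 : ℝ) ^ m) : EuclideanSpace ℝ (Fin 3))
      ≤ 4 / (2 : ℝ) ^ m := by
  have hpow : (0 : ℝ) < (2 : ℝ) ^ m := by positivity
  rw [EuclideanSpace.dist_eq]
  have hcoord : ∀ i : Fin 3,
      dist (x i) ((WithLp.toLp 2 (fun i => (-1 : ℝ) + 2 * (j i : ℕ) / (2 : ℝ) ^ m) :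
        EuclideanSpace ℝ (Fin 3)) i) ^ 2 ≤ (2 / (2 : ℝ) ^ m) ^ 2 := by
    intro i
    obtain ⟨h1, h2⟩ := hx i
    have hxi : (WithLp.toLp 2 (fun i => (-1 : ℝ) + 2 * (j i : ℕ) / (2 : ℝ) ^ m) :
        EuclideanSpace ℝ (Fin 3)) i = (-1 : ℝ) + 2 * (j i : ℕ) / (2 : ℝ) ^ m := by simp
    rw [hxi, Real.dist_eq]
    have hnn : 0 ≤ x i - ((-1 : ℝ) + 2 * (j i : ℕ) / (2 : ℝ) ^ m) := by linarith
    have hub : x i - ((-1 : ℝ) + 2 * (j i : ℕ) / (2 : ℝ) ^ m) ≤ 2 / (2 : ℝ) ^ m := by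
      have : 2 * (((j i : ℕ) : ℝ) + 1) / (2 : ℝ) ^ m = 2 * (j i : ℕ) / (2 : ℝ) ^ m + 2 / (2 : ℝ) ^ m := by
        ring
      linarith
    rw [abs_of_nonneg hnn]
    exact pow_le_pow_left₀ hnn hub 2
  calc Real.sqrt (∑ i : Fin 3, dist (x i) ((WithLp.toLp 2 (fun i => (-1 : ℝ) + 2 * (j i : ℕ) / (2 : ℝ) ^ m) :
          EuclideanSpace ℝ (Fin 3)) i) ^ 2)
      ≤ Real.sqrt (∑ _i : Fin 3, (2 / (2 : ℝ) ^ m) ^ 2) :=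
        Real.sqrt_le_sqrt (Finset.sum_le_sum fun i _ => hcoord i)
    _ ≤ Real.sqrt ((4 / (2 : ℝ) ^ m) ^ 2) := by
        apply Real.sqrt_le_sqrt
        simp only [Finset.sum_const, Finset.card_univ, Fintype.card_fin, nsmul_eq_mul, Nat.cast_ofNat]
        rw [div_pow, div_pow, ← mul_div_assoc]
        exact div_le_div_of_nonneg_right (by norm_num) (by positivity)
    _ = 4 / (2 : ℝ) ^ m := Real.sqrt_sq (by positivity)

/-- **Dyadic step functions are dense in `L²(Q; F)`.**  The span of the indicator functions of the
dyadic cells `D_{m,j}` times constant vectors is dense in `Lp F 2 (volume.restrict Q)`.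
[folklore: Lusin-type density of bounded continuous functions + uniform continuity on the compact
cube] [cite: Simon1996, §2.9 Lemma 1 (compactness of energy minimising maps; supporting lemma)] -/
theorem dense_span_indicatorConstLp_dyadicCell :
    Dense (Submodule.span ℝ
      {f : Lp F 2 (volume.restrict {x : EuclideanSpace ℝ (Fin 3) | ∀ i : Fin 3, |x i| < 1}) |
        ∃ (i : (m : ℕ) × (Fin 3 → Fin (2 ^ m))) (c : F),
          f = indicatorConstLp 2 (measurableSet_dyadicCube i.1 i.2) (measure_dyadicCell_ne_top i.1 i.2) c} :
      Set (Lp F 2 (volume.restrict {x : EuclideanSpace ℝ (Fin 3) | ∀ i : Fin 3, |x i| < 1}))) := by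
  haveI : IsFiniteMeasure (volume.restrict {x : EuclideanSpace ℝ (Fin 3) | ∀ i : Fin 3, |x i| < 1}) :=
    isFiniteMeasure_restrict.2 volume_openCube_lt_top.ne
  rw [Metric.dense_iff]
  intro f ε hε
  -- Step 1: a bounded continuous approximation
  have hf : MemLp (f : EuclideanSpace ℝ (Fin 3) → F) 2
      (volume.restrict {x : EuclideanSpace ℝ (Fin 3) | ∀ i : Fin 3, |x i| < 1}) := Lp.memLp f
  have hε3 : ENNReal.ofReal (ε / 3) ≠ 0 := (ENNReal.ofReal_pos.2 (by positivity)).ne'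
  obtain ⟨g, hg_approx, hg_mem⟩ :=
    hf.exists_boundedContinuous_eLpNorm_sub_le ENNReal.ofNat_ne_top hε3
  have hdist1 : dist f (hg_mem.toLp g) ≤ ε / 3 := by
    rw [Lp.dist_def]
    have : eLpNorm (⇑f - ⇑(hg_mem.toLp g)) 2
        (volume.restrict {x : EuclideanSpace ℝ (Fin 3) | ∀ i : Fin 3, |x i| < 1}) =
        eLpNorm (⇑f - (g : EuclideanSpace ℝ (Fin 3) → F)) 2
        (volume.restrict {x : EuclideanSpace ℝ (Fin 3) | ∀ i : Fin 3, |x i| < 1}) :=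
      eLpNorm_congr_ae (by
        filter_upwards [hg_mem.coeFn_toLp] with x hx
        simp only [Pi.sub_apply, hx])
    rw [this]
    exact ENNReal.toReal_le_of_le_ofReal (by positivity) hg_approx
  -- Step 2: uniform continuity of `g` on the compact closed cube
  have hUC := (isCompact_absCubeClosed (zero_le_one : (0 : ℝ) ≤ 1)).uniformContinuousOn_of_continuous
    g.continuous.continuousOn
  rw [Metric.uniformContinuousOn_iff_le] at hUC
  obtain ⟨δ, hδ, hδUC⟩ := hUC (ε / 9) (by positivity)
  -- Step 3: a level `m` with `4/2^m ≤ δ`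
  obtain ⟨m, hm⟩ : ∃ m : ℕ, 4 / (2 : ℝ) ^ m ≤ δ := by
    obtain ⟨n, hn⟩ := exists_nat_gt (4 / δ)
    refine ⟨n, ?_⟩
    have h2n : (n : ℝ) < (2 : ℝ) ^ n := by exact_mod_cast Nat.lt_two_pow_self
    have hpos : (0 : ℝ) < (2 : ℝ) ^ n := by positivity
    rw [div_le_iff₀ hpos]
    have h4 : 4 < (2 : ℝ) ^ n * δ := by
      have := (div_lt_iff₀ hδ).1 (hn.trans h2n)
      linarith
    linarith
  have hpow : (0 : ℝ) < (2 : ℝ) ^ m := by positivity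
  -- Step 4: the dyadic step function at level `m`, as a function `σ` and as an `L²` element `S`
  set σ : EuclideanSpace ℝ (Fin 3) → F := fun x => ∑ j : Fin 3 → Fin (2 ^ m),
    {x : EuclideanSpace ℝ (Fin 3) | ∀ i : Fin 3,
      (-1 : ℝ) + 2 * (j i : ℕ) / (2 : ℝ) ^ m ≤ x i ∧ x i < (-1 : ℝ) + 2 * ((j i : ℕ) + 1) / (2 : ℝ) ^ m}.indicator
      (fun _ => g (WithLp.toLp 2 (fun i => (-1 : ℝ) + 2 * (j i : ℕ) / (2 : ℝ) ^ m))) x with hσ_def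
  set S : Lp F 2 (volume.restrict {x : EuclideanSpace ℝ (Fin 3) | ∀ i : Fin 3, |x i| < 1}) :=
    ∑ j : Fin 3 → Fin (2 ^ m), indicatorConstLp 2 (measurableSet_dyadicCube m j)
      (measure_dyadicCell_ne_top m j) (g (WithLp.toLp 2 (fun i => (-1 : ℝ) + 2 * (j i : ℕ) / (2 : ℝ) ^ m)))
    with hS_def
  have hS_mem : S ∈ Submodule.span ℝ
      {f : Lp F 2 (volume.restrict {x : EuclideanSpace ℝ (Fin 3) | ∀ i : Fin 3, |x i| < 1}) |
        ∃ (i : (m : ℕ) × (Fin 3 → Fin (2 ^ m))) (c : F),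
          f = indicatorConstLp 2 (measurableSet_dyadicCube i.1 i.2) (measure_dyadicCell_ne_top i.1 i.2) c} := by
    rw [hS_def]
    exact Submodule.sum_mem _ fun j _ => Submodule.subset_span ⟨⟨m, j⟩, _, rfl⟩
  have hS_ae : ∀ᵐ x ∂(volume.restrict {x : EuclideanSpace ℝ (Fin 3) | ∀ i : Fin 3, |x i| < 1}), S x = σ x := by
    have h1 := Lp.coeFn_fun_finsetSum (Finset.univ : Finset (Fin 3 → Fin (2 ^ m)))
      (fun j => indicatorConstLp 2 (measurableSet_dyadicCube m j) (measure_dyadicCell_ne_top m j)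
        (μ := volume.restrict {x : EuclideanSpace ℝ (Fin 3) | ∀ i : Fin 3, |x i| < 1})
        (g (WithLp.toLp 2 (fun i => (-1 : ℝ) + 2 * (j i : ℕ) / (2 : ℝ) ^ m))))
    have h2 : ∀ᵐ x ∂(volume.restrict {x : EuclideanSpace ℝ (Fin 3) | ∀ i : Fin 3, |x i| < 1}),
        ∀ j : Fin 3 → Fin (2 ^ m),
          (indicatorConstLp 2 (measurableSet_dyadicCube m j) (measure_dyadicCell_ne_top m j)
            (μ := volume.restrict {x : EuclideanSpace ℝ (Fin 3) | ∀ i : Fin 3, |x i| < 1})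
            (g (WithLp.toLp 2 (fun i => (-1 : ℝ) + 2 * (j i : ℕ) / (2 : ℝ) ^ m))) :
              EuclideanSpace ℝ (Fin 3) → F) x =
          {x : EuclideanSpace ℝ (Fin 3) | ∀ i : Fin 3,
            (-1 : ℝ) + 2 * (j i : ℕ) / (2 : ℝ) ^ m ≤ x i ∧ x i < (-1 : ℝ) + 2 * ((j i : ℕ) + 1) / (2 : ℝ) ^ m}.indicator
            (fun _ => g (WithLp.toLp 2 (fun i => (-1 : ℝ) + 2 * (j i : ℕ) / (2 : ℝ) ^ m))) x :=
      eventually_all.2 fun j => indicatorConstLp_coeFn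
    filter_upwards [h1, h2] with x hx1 hx2
    rw [hS_def, hx1, hσ_def]
    exact Finset.sum_congr rfl fun j _ => hx2 j
  -- Step 5: pointwise bound on `Q`
  have hptw : ∀ x ∈ {x : EuclideanSpace ℝ (Fin 3) | ∀ i : Fin 3, |x i| < 1},
      ‖(g : EuclideanSpace ℝ (Fin 3) → F) x - σ x‖ ≤ ε / 9 := by
    intro x hxQ
    have hxC := openCube_subset_halfOpenCube hxQ
    obtain ⟨j, hj⟩ := exists_mem_dyadicCell m hxC
    have hσx : σ x = g (WithLp.toLp 2 (fun i => (-1 : ℝ) + 2 * (j i : ℕ) / (2 : ℝ) ^ m)) := by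
      rw [hσ_def]
      simp only
      rw [Finset.sum_eq_single j]
      · rw [indicator_of_mem (by exact hj)]
      · intro j' _ hj'
        rw [indicator_of_notMem]
        intro hx'
        exact hj' (dyadicCell_index_unique m hx' hj)
      · intro h; exact absurd (Finset.mem_univ j) h
    rw [hσx, ← dist_eq_norm]
    have hxK : x ∈ {x : EuclideanSpace ℝ (Fin 3) | ∀ i : Fin 3, |x i| ≤ 1} := fun i => (hxQ i).le
    have hcK : (WithLp.toLp 2 (fun i => (-1 : ℝ) + 2 * (j i : ℕ) / (2 : ℝ) ^ m) : EuclideanSpace ℝ (Fin 3)) ∈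
        {x : EuclideanSpace ℝ (Fin 3) | ∀ i : Fin 3, |x i| ≤ 1} := by
      intro i
      have hj2 : ((j i : ℕ) : ℝ) + 1 ≤ (2 : ℝ) ^ m := by exact_mod_cast (j i).isLt
      have e : (WithLp.toLp 2 (fun i => (-1 : ℝ) + 2 * (j i : ℕ) / (2 : ℝ) ^ m) : EuclideanSpace ℝ (Fin 3)) i
          = (-1 : ℝ) + 2 * (j i : ℕ) / (2 : ℝ) ^ m := by simp
      rw [e, abs_le]
      constructor
      · have : (0 : ℝ) ≤ 2 * (j i : ℕ) / (2 : ℝ) ^ m := by positivity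
        linarith
      · have : 2 * ((j i : ℕ) : ℝ) / (2 : ℝ) ^ m ≤ 2 := by
          rw [div_le_iff₀ hpow]; nlinarith
        linarith
    exact hδUC x hxK _ hcK ((dist_lowerCorner_le m j hj).trans hm)
  -- Step 6: the `L²` distance from `g` to the step function
  have hdist2 : dist (hg_mem.toLp g) S < ε / 3 := by
    rw [dist_eq_norm]
    have hsq : ‖hg_mem.toLp g - S‖ ^ 2 ≤ 8 * (ε / 9) ^ 2 := by
      rw [norm_Lp_two_sq]
      have hint : Integrable (fun x => ‖(hg_mem.toLp g - S) x‖ ^ 2)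
          (volume.restrict {x : EuclideanSpace ℝ (Fin 3) | ∀ i : Fin 3, |x i| < 1}) := by
        have h2 : MemLp ((hg_mem.toLp g - S : Lp F 2 _) : EuclideanSpace ℝ (Fin 3) → F) ((2 : ℕ) : ℝ≥0∞)
            (volume.restrict {x : EuclideanSpace ℝ (Fin 3) | ∀ i : Fin 3, |x i| < 1}) := by
          simpa using Lp.memLp (hg_mem.toLp g - S)
        exact h2.integrable_norm_pow two_ne_zero
      have hle : ∫ x, ‖(hg_mem.toLp g - S) x‖ ^ 2
            ∂(volume.restrict {x : EuclideanSpace ℝ (Fin 3) | ∀ i : Fin 3, |x i| < 1}) ≤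
          ∫ _x, (ε / 9) ^ 2 ∂(volume.restrict {x : EuclideanSpace ℝ (Fin 3) | ∀ i : Fin 3, |x i| < 1}) := by
        refine integral_mono_ae hint (integrable_const _) ?_
        filter_upwards [ae_restrict_mem (isOpen_absCube 1).measurableSet,
          Lp.coeFn_sub (hg_mem.toLp g) S, hg_mem.coeFn_toLp, hS_ae] with x hxQ hsub hgx hSx
        rw [hsub, Pi.sub_apply, hgx, hSx]
        exact pow_le_pow_left₀ (norm_nonneg _) (hptw x hxQ) 2
      refine hle.trans (le_of_eq ?_)
      rw [integral_const, measureReal_restrict_apply_univ, smul_eq_mul, measureReal_def,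
        volume_real_absCube zero_le_one]
      ring
    have hlt : 8 * (ε / 9) ^ 2 < (ε / 3) ^ 2 := by nlinarith
    exact lt_of_pow_lt_pow_left₀ 2 (by positivity) (hsq.trans_lt hlt)
  -- Step 7: conclude
  refine ⟨S, ?_, hS_mem⟩
  rw [Metric.mem_ball, dist_comm]
  calc dist f S ≤ dist f (hg_mem.toLp g) + dist (hg_mem.toLp g) S := dist_triangle _ _ _
    _ < ε / 3 + ε / 3 := add_lt_add_of_le_of_lt hdist1 hdist2
    _ < ε := by linarith

end Density

/-! ## §2 Assembly in Γ1's `(c4)` lettering -/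

/-- **(Γ2-W) The weak `L²(Q; ℝ⁴)` limit from dyadic means.**  Let `v k : ℝ³ → ℝ⁴` be in
`ℒ²(Q)` (`Q = {|xᵢ| < 1}`) with `∫_Q ‖v k‖² ≤ Λ`, and suppose every dyadic-cell mean converges:
`∀ m j, ∃ g, ∫_{D_{m,j}} v k → g` (the `(c4)` clause of Γ1 `stub_blowDownL2Compact`, per direction).
Then there is ONE `G ∈ ℒ²(Q; ℝ⁴)` with `∫_Q ‖G‖² ≤ Λ` such that, along the WHOLE sequence:
`∫_{D_{m,j}} v k → ∫_{D_{m,j}} G` for every cell; `∫_Q ⟪ψ, v k⟫ → ∫_Q ⟪ψ, G⟫` for every `ψ ∈ ℒ²(Q)`;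
and `∫_Q φ • v k → ∫_Q φ • G` in `ℝ⁴` for every bounded a.e.-strongly-measurable scalar `φ` (the
pairing in the `HasWeakFDerivOn` identity). [folklore: Riesz + density of dyadic step functions]
[cite: Simon1996, §2.9 Lemma 1 (compactness of energy minimising maps; supporting lemma)] -/
theorem exists_weakLimit_of_dyadicMeans
    (v : ℕ → EuclideanSpace ℝ (Fin 3) → EuclideanSpace ℝ (Fin 4))
    (hv : ∀ k, MemLp (v k) 2 (volume.restrict {x : EuclideanSpace ℝ (Fin 3) | ∀ i : Fin 3, |x i| < 1}))
    (Λ : ℝ) (hΛ : ∀ k, ∫ x in {x : EuclideanSpace ℝ (Fin 3) | ∀ i : Fin 3, |x i| < 1}, ‖v k x‖ ^ 2 ≤ Λ)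
    (hc4 : ∀ (m : ℕ) (j : Fin 3 → Fin (2 ^ m)), ∃ g : EuclideanSpace ℝ (Fin 4),
      Tendsto (fun k : ℕ => ∫ x in {x : EuclideanSpace ℝ (Fin 3) | ∀ i : Fin 3,
        (-1 : ℝ) + 2 * (j i : ℕ) / (2 : ℝ) ^ m ≤ x i ∧ x i < (-1 : ℝ) + 2 * ((j i : ℕ) + 1) / (2 : ℝ) ^ m}, v k x)
        atTop (𝓝 g)) :
    ∃ G : EuclideanSpace ℝ (Fin 3) → EuclideanSpace ℝ (Fin 4),
      MemLp G 2 (volume.restrict {x : EuclideanSpace ℝ (Fin 3) | ∀ i : Fin 3, |x i| < 1}) ∧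
      ∫ x in {x : EuclideanSpace ℝ (Fin 3) | ∀ i : Fin 3, |x i| < 1}, ‖G x‖ ^ 2 ≤ Λ ∧
      (∀ (m : ℕ) (j : Fin 3 → Fin (2 ^ m)),
        Tendsto (fun k : ℕ => ∫ x in {x : EuclideanSpace ℝ (Fin 3) | ∀ i : Fin 3,
          (-1 : ℝ) + 2 * (j i : ℕ) / (2 : ℝ) ^ m ≤ x i ∧ x i < (-1 : ℝ) + 2 * ((j i : ℕ) + 1) / (2 : ℝ) ^ m}, v k x)
          atTop (𝓝 (∫ x in {x : EuclideanSpace ℝ (Fin 3) | ∀ i : Fin 3,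
          (-1 : ℝ) + 2 * (j i : ℕ) / (2 : ℝ) ^ m ≤ x i ∧ x i < (-1 : ℝ) + 2 * ((j i : ℕ) + 1) / (2 : ℝ) ^ m}, G x))) ∧
      (∀ ψ : EuclideanSpace ℝ (Fin 3) → EuclideanSpace ℝ (Fin 4),
        MemLp ψ 2 (volume.restrict {x : EuclideanSpace ℝ (Fin 3) | ∀ i : Fin 3, |x i| < 1}) →
        Tendsto (fun k : ℕ => ∫ x in {x : EuclideanSpace ℝ (Fin 3) | ∀ i : Fin 3, |x i| < 1}, ⟪ψ x, v k x⟫)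
          atTop (𝓝 (∫ x in {x : EuclideanSpace ℝ (Fin 3) | ∀ i : Fin 3, |x i| < 1}, ⟪ψ x, G x⟫))) ∧
      (∀ (φ : EuclideanSpace ℝ (Fin 3) → ℝ) (B : ℝ),
        AEStronglyMeasurable φ (volume.restrict {x : EuclideanSpace ℝ (Fin 3) | ∀ i : Fin 3, |x i| < 1}) →
        (∀ x, |φ x| ≤ B) →
        Tendsto (fun k : ℕ => ∫ x in {x : EuclideanSpace ℝ (Fin 3) | ∀ i : Fin 3, |x i| < 1}, φ x • v k x)
          atTop (𝓝 (∫ x in {x : EuclideanSpace ℝ (Fin 3) | ∀ i : Fin 3, |x i| < 1}, φ x • G x))) := by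
  haveI : IsFiniteMeasure (volume.restrict {x : EuclideanSpace ℝ (Fin 3) | ∀ i : Fin 3, |x i| < 1}) :=
    isFiniteMeasure_restrict.2 volume_openCube_lt_top.ne
  -- the general `L²` step on the sigma-indexed family of dyadic cells
  have hmean : ∀ i : (m : ℕ) × (Fin 3 → Fin (2 ^ m)), ∃ g : EuclideanSpace ℝ (Fin 4),
      Tendsto (fun k : ℕ => ∫ x in {x : EuclideanSpace ℝ (Fin 3) | ∀ l : Fin 3,
        (-1 : ℝ) + 2 * (i.2 l : ℕ) / (2 : ℝ) ^ i.1 ≤ x l ∧ x l < (-1 : ℝ) + 2 * ((i.2 l : ℕ) + 1) / (2 : ℝ) ^ i.1}, v k x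
        ∂(volume.restrict {x : EuclideanSpace ℝ (Fin 3) | ∀ i : Fin 3, |x i| < 1})) atTop (𝓝 g) := by
    rintro ⟨m, j⟩
    obtain ⟨g, hg⟩ := hc4 m j
    refine ⟨g, ?_⟩
    simp_rw [restrict_openCube_restrict_dyadicCell m j]
    exact hg
  obtain ⟨G, hG, hGΛ, hGmean, hGψ⟩ := exists_weakLimit_of_setIntegral_tendsto
    (μ := volume.restrict {x : EuclideanSpace ℝ (Fin 3) | ∀ i : Fin 3, |x i| < 1})
    (fun i : (m : ℕ) × (Fin 3 → Fin (2 ^ m)) => {x : EuclideanSpace ℝ (Fin 3) | ∀ l : Fin 3,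
      (-1 : ℝ) + 2 * (i.2 l : ℕ) / (2 : ℝ) ^ i.1 ≤ x l ∧ x l < (-1 : ℝ) + 2 * ((i.2 l : ℕ) + 1) / (2 : ℝ) ^ i.1})
    (fun i => measurableSet_dyadicCube i.1 i.2) (fun i => measure_dyadicCell_ne_top i.1 i.2)
    dense_span_indicatorConstLp_dyadicCell v hv Λ hΛ hmean
  refine ⟨G, hG, hGΛ, fun m j => ?_, hGψ, fun φ B hφ hφB => ?_⟩
  · have := hGmean ⟨m, j⟩
    simp_rw [restrict_openCube_restrict_dyadicCell m j] at this
    exact this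
  · -- the vector-valued pairing, coordinate by coordinate in an orthonormal basis of `ℝ⁴`
    have hφtop : MemLp φ ∞ (volume.restrict {x : EuclideanSpace ℝ (Fin 3) | ∀ i : Fin 3, |x i| < 1}) :=
      memLp_top_of_bound hφ B (Eventually.of_forall fun x => by rw [Real.norm_eq_abs]; exact hφB x)
    have hint : ∀ (w : EuclideanSpace ℝ (Fin 3) → EuclideanSpace ℝ (Fin 4)),
        MemLp w 2 (volume.restrict {x : EuclideanSpace ℝ (Fin 3) | ∀ i : Fin 3, |x i| < 1}) →
        Integrable (fun x => φ x • w x) (volume.restrict {x : EuclideanSpace ℝ (Fin 3) | ∀ i : Fin 3, |x i| < 1}) :=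
      fun w hw => (hw.integrable one_le_two).smul_of_top_right hφtop
    -- scalar pairings `⟪c, ∫ φ • w⟫ = ∫ ⟪φ • c, w⟫`
    have hscal : ∀ (c : EuclideanSpace ℝ (Fin 4)) (w : EuclideanSpace ℝ (Fin 3) → EuclideanSpace ℝ (Fin 4)),
        MemLp w 2 (volume.restrict {x : EuclideanSpace ℝ (Fin 3) | ∀ i : Fin 3, |x i| < 1}) →
        ⟪c, ∫ x in {x : EuclideanSpace ℝ (Fin 3) | ∀ i : Fin 3, |x i| < 1}, φ x • w x⟫ =
          ∫ x in {x : EuclideanSpace ℝ (Fin 3) | ∀ i : Fin 3, |x i| < 1}, ⟪φ x • c, w x⟫ := by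
      intro c w hw
      rw [← integral_inner (hint w hw) c]
      refine integral_congr_ae (Eventually.of_forall fun x => ?_)
      simp only [real_inner_smul_left, real_inner_smul_right]
    have hψc : ∀ c : EuclideanSpace ℝ (Fin 4), MemLp (fun x => φ x • c) 2
        (volume.restrict {x : EuclideanSpace ℝ (Fin 3) | ∀ i : Fin 3, |x i| < 1}) := fun c =>
      MemLp.of_bound (hφ.smul_const c) (B * ‖c‖) (Eventually.of_forall fun x => by
        rw [norm_smul, Real.norm_eq_abs]
        exact mul_le_mul_of_nonneg_right (hφB x) (norm_nonneg _))
    have hcoord : ∀ c : EuclideanSpace ℝ (Fin 4),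
        Tendsto (fun k : ℕ => ⟪c, ∫ x in {x : EuclideanSpace ℝ (Fin 3) | ∀ i : Fin 3, |x i| < 1}, φ x • v k x⟫)
          atTop (𝓝 ⟪c, ∫ x in {x : EuclideanSpace ℝ (Fin 3) | ∀ i : Fin 3, |x i| < 1}, φ x • G x⟫) := by
      intro c
      have h := hGψ (fun x => φ x • c) (hψc c)
      rw [hscal c G hG]
      simp_rw [hscal c (v _) (hv _)]
      exact h
    -- reassemble the vector from its coordinates in the standard orthonormal basis
    have key : ∀ y : EuclideanSpace ℝ (Fin 4),
        ∑ a, ⟪(EuclideanSpace.basisFun (Fin 4) ℝ) a, y⟫ • (EuclideanSpace.basisFun (Fin 4) ℝ) a = y :=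
      fun y => (EuclideanSpace.basisFun (Fin 4) ℝ).sum_repr' y
    have hsum := tendsto_finsetSum (Finset.univ : Finset (Fin 4))
      (fun a _ => (hcoord ((EuclideanSpace.basisFun (Fin 4) ℝ) a)).smul_const
        ((EuclideanSpace.basisFun (Fin 4) ℝ) a))
    simp only [key] at hsum
    exact hsum

end Literature.Analysis.PDE.MinimisingMaps

end Part8

/-!
## Part 9 — port of `Summits/QuantumFields/YangMills/Theorems/PoincareLipschitzLatticeToContinuumSobolevLetters.lean` (2 declarations kept)

# Energy minimising maps into `S³` (Hardt–Kinderlehrer–Lin / Luckhaus / Simon §2.9): Lattice To Continuum Sobolev Letters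

Declarations of this Part (verbatim port; each keeps its own docstring and citation): `exists_unit_representative`, `weakFDeriv_ae_eq_of_eqOn`.

Reference keys (see `references.bib` and the declarations' citations): [Evans2010], [Simon1996].
-/

section Part9

open scoped _root_.BigOperators
open _root_.MeasureTheory _root_.Set _root_.Filter _root_.Topology _root_.TopologicalSpace

namespace Literature.Analysis.PDE.MinimisingMaps

open Literature.Analysis.FunctionSpaces (HasWeakFDerivOn IsTestFunctionOn)

/-! ## §1 The everywhere-unit representative and a.e.-congruence of weak gradients -/

/-- **THE EVERYWHERE-UNIT REPRESENTATIVE.**  An a.e.-strongly measurable map which is unit a.e. (w.r.t. `μ`) agrees `μ`-a.e. with a MEASURABLE map which is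
unit EVERYWHERE (modify on the null set to a fixed unit vector). [cite: Evans2010, §5.2.1] -/
theorem exists_unit_representative {X : Type*} [MeasurableSpace X] {μ : Measure X}
    (U₀ : X → EuclideanSpace ℝ (Fin 4)) (hm : AEStronglyMeasurable U₀ μ) (h1 : ∀ᵐ x ∂μ, ‖U₀ x‖ = 1) :
    ∃ U : X → EuclideanSpace ℝ (Fin 4), Measurable U ∧ (∀ x, ‖U x‖ = 1) ∧ (∀ᵐ x ∂μ, U x = U₀ x) := by
  classical
  set V := hm.mk U₀ with hV
  have hVm : StronglyMeasurable V := hm.stronglyMeasurable_mk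
  set e₀ : EuclideanSpace ℝ (Fin 4) := EuclideanSpace.single 0 1 with he₀
  have he₀1 : ‖e₀‖ = 1 := by rw [he₀]; simp
  refine ⟨fun x => if ‖V x‖ = 1 then V x else e₀, ?_, ?_, ?_⟩
  · refine Measurable.ite ?_ hVm.measurable measurable_const
    exact hVm.measurable.norm (measurableSet_singleton (1 : ℝ))
  · intro x
    by_cases hx : ‖V x‖ = 1
    · simp only [hx, if_true]
    · simp only [hx, if_false, he₀1]
  · filter_upwards [hm.ae_eq_mk, h1] with x hx hx1
    have hVx : V x = U₀ x := hx.symm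
    have h1' : ‖V x‖ = 1 := by rw [hVx, hx1]
    rw [if_pos h1', hVx]

/-- **LOCALITY.**  If `U` has weak gradient `G` and `V` has weak gradient `GV` on `Ω`, and `V = U` on an open `Ω' ⊆ Ω`, then `GV = G` `μ`-a.e. on `Ω'`
(restrict both to `Ω'` by lit `mono_set_holds`, transport `V`'s identity to `U` pointwise on `Ω'`, conclude by lit `unique_holds`). [cite: Evans2010, §5.2.1] -/
theorem weakFDeriv_ae_eq_of_eqOn {E' : Type*} [NormedAddCommGroup E'] [NormedSpace ℝ E'] [MeasurableSpace E'] [FiniteDimensional ℝ E'] [BorelSpace E']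
    {F : Type*} [NormedAddCommGroup F] [NormedSpace ℝ F] [CompleteSpace F]
    {Ω Ω' : Opens E'} {μ : Measure E'} {U V : E' → F} {G GV : E' → E' →L[ℝ] F}
    (hU : HasWeakFDerivOn Ω μ U G) (hV : HasWeakFDerivOn Ω μ V GV) (hΩ : Ω' ≤ Ω) (hVU : ∀ x ∈ (Ω' : Set E'), V x = U x) :
    GV =ᵐ[μ.restrict (Ω' : Set E')] G := by
  have hU' := Literature.Analysis.FunctionSpaces.HasWeakFDerivOn.mono_set_holds hU hΩ
  have hV' := Literature.Analysis.FunctionSpaces.HasWeakFDerivOn.mono_set_holds hV hΩ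
  have hV'' : HasWeakFDerivOn Ω' μ U GV := by
    refine ⟨hU'.locallyIntegrableOn, hV'.locallyIntegrableOn_deriv, fun φ v hφ => ?_⟩
    rw [← hV'.integral_fderiv_smul_eq φ v hφ]
    exact setIntegral_congr_fun Ω'.isOpen.measurableSet fun x hx => by rw [hVU x hx]
  exact Literature.Analysis.FunctionSpaces.HasWeakFDerivOn.unique_holds hV'' hU'

end Literature.Analysis.PDE.MinimisingMaps

end Part9

/-!
## Part 10 — port of `Summits/QuantumFields/YangMills/Theorems/PoincareLipschitzBlowDownWeakGradientLetters.lean` (4 declarations kept)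

# Energy minimising maps into `S³` (Hardt–Kinderlehrer–Lin / Luckhaus / Simon §2.9): Blow Down Weak Gradient Letters

Declarations of this Part (verbatim port; each keeps its own docstring and citation): `integrable_of_norm_le`, `tendsto_setIntegral_norm_of_sq`, `sum_smulRight_apply_single`, `sum_smulRight_apply`.

Reference keys (see `references.bib` and the declarations' citations): [Evans2010], [AlicandroCicalese2008].
-/

section Part10

open scoped _root_.BigOperators _root_.ENNReal _root_.Topology
open _root_.MeasureTheory _root_.Set _root_.Filter

namespace Literature.Analysis.PDE.MinimisingMaps

open Literature.MathematicalPhysics.QuantumFieldTheory.Balaban1983to89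
open B4Eq19LatticeOperators (Zd box unitVec)

/-! ## §1 Letters: bounded measurable maps are integrable on finite measures; the lattice shift identity; `L² → L¹` -/

/-- A bounded a.e.-strongly measurable function is integrable for a finite measure. [cite: Simon1996, §2.9 Lemma 1 (compactness of energy minimising maps; supporting lemma)] -/
theorem integrable_of_norm_le {α F : Type*} [MeasurableSpace α] {ν : Measure α} [IsFiniteMeasure ν]
    [NormedAddCommGroup F] {f : α → F} (hf : AEStronglyMeasurable f ν) (C : ℝ) (h : ∀ᵐ x ∂ν, ‖f x‖ ≤ C) :
    Integrable f ν :=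
  memLp_one_iff_integrable.1 (MemLp.of_bound hf C h)

/-- From `L²` to `L¹` on a set of finite volume without Hölder: if `∫_S ‖d k‖² → 0` for uniformly bounded measurable `d k`, then
`∫_S ‖d k‖ → 0` (pointwise `‖d‖ ≤ η∕2 + ‖d‖²∕(2η)` for every `η > 0`). [cite: Simon1996, §2.9 Lemma 1 (compactness of energy minimising maps; supporting lemma)] -/
theorem tendsto_setIntegral_norm_of_sq {d : ℕ → EuclideanSpace ℝ (Fin 3) → EuclideanSpace ℝ (Fin 4)} {S : Set (EuclideanSpace ℝ (Fin 3))}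
    (hS : volume S < ∞) (hdm : ∀ k, AEStronglyMeasurable (d k) (volume.restrict S)) {C : ℝ}
    (hdC : ∀ k, ∀ᵐ x ∂(volume.restrict S), ‖d k x‖ ≤ C)
    (h2 : Tendsto (fun k => ∫ x in S, ‖d k x‖ ^ 2) atTop (𝓝 0)) :
    Tendsto (fun k => ∫ x in S, ‖d k x‖) atTop (𝓝 0) := by
  haveI : IsFiniteMeasure (volume.restrict S) := ⟨by rwa [Measure.restrict_apply_univ]⟩
  set V : ℝ := (volume S).toReal with hV
  have hV0 : 0 ≤ V := ENNReal.toReal_nonneg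
  rw [Metric.tendsto_atTop]
  intro ε hε
  set η : ℝ := ε / (V + 1) with hη
  have hη0 : 0 < η := div_pos hε (by linarith)
  have hηV : η * V < ε := by
    have : η * (V + 1) = ε := by rw [hη]; field_simp
    nlinarith
  obtain ⟨N, hN⟩ := (Metric.tendsto_atTop.1 h2) (η * ε) (mul_pos hη0 hε)
  refine ⟨N, fun k hk => ?_⟩
  have h2k := hN k hk
  have hI0 : 0 ≤ ∫ x in S, ‖d k x‖ := integral_nonneg fun x => norm_nonneg _
  have hI20 : 0 ≤ ∫ x in S, ‖d k x‖ ^ 2 := integral_nonneg fun x => by positivity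
  rw [Real.dist_eq, sub_zero, abs_of_nonneg hI20] at h2k
  rw [Real.dist_eq, sub_zero, abs_of_nonneg hI0]
  -- pointwise bound and integrate
  have hptw : ∀ x, ‖d k x‖ ≤ η / 2 + (2 * η)⁻¹ * ‖d k x‖ ^ 2 := by
    intro x
    have hsq : 0 ≤ (‖d k x‖ - η) ^ 2 := sq_nonneg _
    have h1 : ‖d k x‖ * (2 * η) ≤ η ^ 2 + ‖d k x‖ ^ 2 := by nlinarith
    have h2η : 0 < 2 * η := by linarith
    calc ‖d k x‖ = ‖d k x‖ * (2 * η) * (2 * η)⁻¹ := by field_simp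
      _ ≤ (η ^ 2 + ‖d k x‖ ^ 2) * (2 * η)⁻¹ := by gcongr
      _ = η / 2 + (2 * η)⁻¹ * ‖d k x‖ ^ 2 := by field_simp
  have hint1 : Integrable (fun x => ‖d k x‖) (volume.restrict S) :=
    (integrable_of_norm_le (hdm k) C (hdC k)).norm
  have hint2 : Integrable (fun x => ‖d k x‖ ^ 2) (volume.restrict S) := by
    refine integrable_of_norm_le ((hdm k).norm.pow 2) (C ^ 2) ?_
    filter_upwards [hdC k] with x hx
    rw [Real.norm_eq_abs, abs_of_nonneg (by positivity)]
    exact pow_le_pow_left₀ (norm_nonneg _) hx 2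
  have hle : ∫ x in S, ‖d k x‖ ≤ ∫ x in S, (η / 2 + (2 * η)⁻¹ * ‖d k x‖ ^ 2) :=
    integral_mono hint1 ((integrable_const _).add (hint2.const_mul _)) hptw
  rw [integral_add (integrable_const _) (hint2.const_mul _), integral_const_mul, setIntegral_const] at hle
  have hreal : (volume.real S) = V := by rw [hV, measureReal_def]
  rw [hreal, smul_eq_mul] at hle
  have h3 : (2 * η)⁻¹ * ∫ x in S, ‖d k x‖ ^ 2 ≤ (2 * η)⁻¹ * (η * ε) :=
    mul_le_mul_of_nonneg_left h2k.le (by positivity)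
  have h4 : (2 * η)⁻¹ * (η * ε) = ε / 2 := by field_simp
  nlinarith [hle, h3, h4, hηV, hη0, hV0]

/-! ## §2 The bundled gradient `v ↦ Σ_μ v_μ • G_μ x` -/

/-- The bundled weak gradient: the continuous linear map `v ↦ Σ_μ v_μ • G_μ x` evaluated at a basis vector returns `G_i x` — so the density letter
`Σ_i ‖G x (single i 1)‖²` is `Σ_i ‖G_i x‖²`. [cite: Simon1996, §2.9 Lemma 1 (compactness of energy minimising maps; supporting lemma)] -/
theorem sum_smulRight_apply_single (G : Fin 3 → EuclideanSpace ℝ (Fin 3) → EuclideanSpace ℝ (Fin 4))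
    (x : EuclideanSpace ℝ (Fin 3)) (i : Fin 3) :
    (∑ μ : Fin 3, (EuclideanSpace.proj μ).smulRight (G μ x)) (EuclideanSpace.single i (1:ℝ)) = G i x := by
  simp [ContinuousLinearMap.smulRight_apply]

/-- The bundled weak gradient applied to a general vector: `(Σ_μ proj_μ.smulRight (G_μ x)) v = Σ_μ v_μ • G_μ x`. [cite: Simon1996, §2.9 Lemma 1 (compactness of energy minimising maps; supporting lemma)] -/
theorem sum_smulRight_apply (G : Fin 3 → EuclideanSpace ℝ (Fin 3) → EuclideanSpace ℝ (Fin 4))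
    (x v : EuclideanSpace ℝ (Fin 3)) :
    (∑ μ : Fin 3, (EuclideanSpace.proj μ).smulRight (G μ x)) v = ∑ μ : Fin 3, v μ • G μ x := by
  simp [ContinuousLinearMap.smulRight_apply]

end Literature.Analysis.PDE.MinimisingMaps

end Part10

/-!
## Part 11 — port of `Summits/QuantumFields/YangMills/Theorems/PoincareLipschitzSobolevCubeExtractionLetters.lean` (5 declarations kept)

# Energy minimising maps into `S³` (Hardt–Kinderlehrer–Lin / Luckhaus / Simon §2.9): Sobolev Cube Extraction Letters

Declarations of this Part (verbatim port; each keeps its own docstring and citation): `opNorm_sq_le_dens`, `eLpNorm_le_sqrt_integral_dens`, `exists_subseq_unit_limit`, `integrable_real_inner_of_sq`, `tendsto_setIntegral_smul_of_sq`.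

Reference keys (see `references.bib` and the declarations' citations): [Simon1996], [HardtKinderlehrerLin1986], [Evans2010].
-/

section Part11

open _root_.MeasureTheory _root_.Set _root_.Function _root_.Filter _root_.Topology _root_.Metric _root_.TopologicalSpace
open scoped _root_.ContDiff _root_.ENNReal RealInnerProductSpace _root_.BigOperators

namespace Literature.Analysis.PDE.MinimisingMaps

open Literature.Analysis.FunctionSpaces

/-! ## §1 Letters: operator norm against the density, `L²` bound of the gradients -/

/-- **Operator norm against the standard basis**: `‖T v‖ ≤ ‖v‖·(Σ_i ‖T e_i‖²)^{1∕2}`, so `‖T‖² ≤ Σ_i ‖T e_i‖²`. [cite: Evans2010, §5.7 Theorem 1] -/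
theorem opNorm_sq_le_dens {F : Type*} [NormedAddCommGroup F] [InnerProductSpace ℝ F]
    (T : EuclideanSpace ℝ (Fin 3) →L[ℝ] F) :
    ‖T‖ ^ 2 ≤ ∑ i : Fin 3, ‖T (EuclideanSpace.single i (1:ℝ))‖ ^ 2 := by
  have hD0 : 0 ≤ ∑ i : Fin 3, ‖T (EuclideanSpace.single i (1:ℝ))‖ ^ 2 := Finset.sum_nonneg fun i _ => sq_nonneg _
  have hop : ‖T‖ ≤ Real.sqrt (∑ i : Fin 3, ‖T (EuclideanSpace.single i (1:ℝ))‖ ^ 2) := by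
    refine ContinuousLinearMap.opNorm_le_bound _ (Real.sqrt_nonneg _) fun v => ?_
    have hv : T v = ∑ i : Fin 3, v i • T (EuclideanSpace.single i (1:ℝ)) := by
      conv_lhs => rw [← (EuclideanSpace.basisFun (Fin 3) ℝ).sum_repr v]
      rw [map_sum]
      refine Finset.sum_congr rfl fun i _ => ?_
      rw [map_smul, EuclideanSpace.basisFun_repr, EuclideanSpace.basisFun_apply]
    rw [hv]
    refine (norm_sum_le _ _).trans ?_
    have hcs := Real.sum_mul_le_sqrt_mul_sqrt (Finset.univ : Finset (Fin 3)) (fun i => |v i|)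
      (fun i => ‖T (EuclideanSpace.single i (1:ℝ))‖)
    have h1 : ∑ i : Fin 3, ‖v i • T (EuclideanSpace.single i (1:ℝ))‖ =
        ∑ i : Fin 3, |v i| * ‖T (EuclideanSpace.single i (1:ℝ))‖ := by
      refine Finset.sum_congr rfl fun i _ => ?_
      rw [norm_smul, Real.norm_eq_abs]
    rw [h1]
    refine hcs.trans (le_of_eq ?_)
    have h2 : Real.sqrt (∑ i : Fin 3, |v i| ^ 2) = ‖v‖ := by
      simp only [EuclideanSpace.norm_eq, Real.norm_eq_abs]
    rw [h2, mul_comm]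
  nlinarith [Real.sq_sqrt hD0, norm_nonneg T, Real.sqrt_nonneg (∑ i : Fin 3, ‖T (EuclideanSpace.single i (1:ℝ))‖ ^ 2)]

/-- **`L²` bound of an operator field by the integral of the density**: `‖G‖_{L²(S)} ≤ (∫_S Σ_i‖G e_i‖²)^{1∕2}`. [cite: Evans2010, §5.7 Theorem 1] -/
theorem eLpNorm_le_sqrt_integral_dens {F : Type*} [NormedAddCommGroup F] [InnerProductSpace ℝ F]
    {S : Set (EuclideanSpace ℝ (Fin 3))} {G : EuclideanSpace ℝ (Fin 3) → EuclideanSpace ℝ (Fin 3) →L[ℝ] F}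
    (hGi : IntegrableOn (fun x => ∑ i : Fin 3, ‖G x (EuclideanSpace.single i (1:ℝ))‖ ^ 2) S volume) :
    eLpNorm G 2 (volume.restrict S) ≤
      (ENNReal.ofReal (∫ x in S, ∑ i : Fin 3, ‖G x (EuclideanSpace.single i (1:ℝ))‖ ^ 2)) ^ ((1:ℝ) / 2) := by
  rw [eLpNorm_eq_lintegral_rpow_enorm_toReal two_ne_zero ENNReal.ofNat_ne_top, ENNReal.toReal_ofNat]
  refine ENNReal.rpow_le_rpow ?_ (by norm_num)
  rw [ofReal_integral_eq_lintegral_ofReal hGi (Filter.Eventually.of_forall fun x =>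
    Finset.sum_nonneg fun i _ => sq_nonneg _)]
  refine lintegral_mono fun x => ?_
  have h1 : (‖G x‖ₑ : ℝ≥0∞) ^ (2:ℝ) = ENNReal.ofReal (‖G x‖ ^ 2) := by
    rw [← ofReal_norm, ENNReal.ofReal_rpow_of_nonneg (norm_nonneg _) (by norm_num : (0:ℝ) ≤ 2), Real.rpow_two]
  rw [h1]
  exact ENNReal.ofReal_le_ofReal (opNorm_sq_le_dens (G x))

/-! ## §2 Strong `L²(Q)` limit with a unit representative -/

/-- **STRONG `L²(Q)` SUBSEQUENTIAL LIMIT OF UNIT MAPS WITH BOUNDED ENERGY, UNIT EVERYWHERE.**  For unit maps `u_j` on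
the open unit cube `Q` with weak gradients of energy `≤ Λ`: a subsequence `φ`, a measurable `U` with `‖U‖ = 1`
EVERYWHERE, `u_{φ j} → U` a.e. on `Q` and `∫_Q ‖u_{φ j} − U‖² → 0`. [cite: Evans2010, §5.7 Theorem 1] -/
theorem exists_subseq_unit_limit (hQ : IsOpen {x : EuclideanSpace ℝ (Fin 3) | ∀ i : Fin 3, |x i| < 1})
    (u : ℕ → EuclideanSpace ℝ (Fin 3) → EuclideanSpace ℝ (Fin 4))
    (Gs : ℕ → EuclideanSpace ℝ (Fin 3) → (EuclideanSpace ℝ (Fin 3) →L[ℝ] EuclideanSpace ℝ (Fin 4))) (Λ : ℝ)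
    (hu : ∀ j, HasWeakFDerivOn ⟨{x : EuclideanSpace ℝ (Fin 3) | ∀ i : Fin 3, |x i| < 1}, hQ⟩ volume (u j) (Gs j))
    (hu1 : ∀ j (x : EuclideanSpace ℝ (Fin 3)), (∀ i : Fin 3, |x i| < 1) → ‖u j x‖ = 1)
    (hGi : ∀ j, IntegrableOn (fun x => ∑ i : Fin 3, ‖Gs j x (EuclideanSpace.single i (1:ℝ))‖ ^ 2)
      {x : EuclideanSpace ℝ (Fin 3) | ∀ i : Fin 3, |x i| < 1} volume)
    (hΛ : ∀ j, ∫ x in {x : EuclideanSpace ℝ (Fin 3) | ∀ i : Fin 3, |x i| < 1},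
      ∑ i : Fin 3, ‖Gs j x (EuclideanSpace.single i (1:ℝ))‖ ^ 2 ≤ Λ) :
    ∃ (U : EuclideanSpace ℝ (Fin 3) → EuclideanSpace ℝ (Fin 4)) (φ : ℕ → ℕ), StrictMono φ ∧ Measurable U ∧
      (∀ x, ‖U x‖ = 1) ∧
      (∀ᵐ x ∂(volume.restrict {x : EuclideanSpace ℝ (Fin 3) | ∀ i : Fin 3, |x i| < 1}),
        Tendsto (fun j => u (φ j) x) atTop (𝓝 (U x))) ∧
      Tendsto (fun j => ∫ x in {x : EuclideanSpace ℝ (Fin 3) | ∀ i : Fin 3, |x i| < 1}, ‖u (φ j) x - U x‖ ^ 2)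
        atTop (𝓝 0) := by
  set Q : Set (EuclideanSpace ℝ (Fin 3)) := {x | ∀ i : Fin 3, |x i| < 1} with hQdef
  have hQm : MeasurableSet Q := hQ.measurableSet
  have hQfin : volume Q < ⊤ := volume_openCube_lt_top
  haveI : IsFiniteMeasure (volume.restrict Q) := isFiniteMeasure_restrict.2 hQfin.ne
  -- `L²` bound of the gradients
  have hΛ0 : 0 ≤ Λ := le_trans (setIntegral_nonneg hQm fun x _ => Finset.sum_nonneg fun i _ => sq_nonneg _) (hΛ 0)
  have hGΛ : ∀ j, eLpNorm (Gs j) 2 (volume.restrict Q) ≤ (ENNReal.ofReal Λ) ^ ((1:ℝ) / 2) := fun j =>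
    (eLpNorm_le_sqrt_integral_dens (hGi j)).trans (ENNReal.rpow_le_rpow (ENNReal.ofReal_le_ofReal (hΛ j)) (by norm_num))
  -- (C-a2)
  obtain ⟨U₀, φ, hφ, hU₀, hL2, hae⟩ := exists_subseq_tendsto_eLpNorm_of_weakGrad (μ := volume)
    (Ω := ⟨Q, hQ⟩) hQfin hu (B := 1) (fun j x hx => (hu1 j x hx).le)
    (ENNReal.rpow_ne_top_of_nonneg (by norm_num) ENNReal.ofReal_ne_top) hGΛ
  -- the limit is unit a.e.; choose a unit representative
  have hU₀1 : ∀ᵐ x ∂(volume.restrict Q), ‖U₀ x‖ = 1 := by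
    filter_upwards [hae, ae_restrict_mem hQm] with x hx hxQ
    have h1 : Tendsto (fun j => ‖u (φ j) x‖) atTop (𝓝 ‖U₀ x‖) := hx.norm
    have h2 : Tendsto (fun j => ‖u (φ j) x‖) atTop (𝓝 1) := by
      simp only [hu1 _ x hxQ]; exact tendsto_const_nhds
    exact tendsto_nhds_unique h1 h2
  obtain ⟨U, hUm, hU1, hUU₀⟩ := exists_unit_representative U₀ hU₀.aestronglyMeasurable hU₀1
  have hae' : ∀ᵐ x ∂(volume.restrict Q), Tendsto (fun j => u (φ j) x) atTop (𝓝 (U x)) := by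
    filter_upwards [hae, hUU₀] with x hx hxU
    rwa [hxU]
  refine ⟨U, φ, hφ, hUm, hU1, hae', ?_⟩
  -- dominated convergence for `∫_Q ‖u_{φ j} − U‖²`
  have hmeas : ∀ j, AEStronglyMeasurable (u j) (volume.restrict Q) :=
    fun j => (hu j).locallyIntegrableOn.aestronglyMeasurable
  have hlim := tendsto_integral_of_dominated_convergence (μ := volume.restrict Q) (bound := fun _ => (4 : ℝ))
    (F := fun j x => ‖u (φ j) x - U x‖ ^ 2) (f := fun _ => (0 : ℝ))
    (fun j => (((hmeas (φ j)).sub hUm.aestronglyMeasurable).norm.pow 2))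
    (integrable_const _) (fun j => ?_) ?_
  · simpa using hlim
  · filter_upwards [ae_restrict_mem hQm] with x hx
    rw [Real.norm_eq_abs, abs_of_nonneg (sq_nonneg _)]
    have h1 : ‖u (φ j) x - U x‖ ≤ 2 := by
      calc ‖u (φ j) x - U x‖ ≤ ‖u (φ j) x‖ + ‖U x‖ := norm_sub_le _ _
        _ = 2 := by rw [hu1 _ x hx, hU1 x]; norm_num
    nlinarith [norm_nonneg (u (φ j) x - U x)]
  · filter_upwards [hae'] with x hx
    have h1 : Tendsto (fun j => ‖u (φ j) x - U x‖) atTop (𝓝 0) := by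
      have h2 := (hx.sub (tendsto_const_nhds (x := U x))).norm
      simpa using h2
    simpa using h1.pow 2

/-! ## §3 Letters for the weak gradient of the limit -/

/-- **Inner products of square-integrable fields are integrable** (`|⟪f,g⟫| ≤ (‖f‖² + ‖g‖²)/2`). [cite: Evans2010, §5.7 Theorem 1] -/
theorem integrable_real_inner_of_sq {X : Type*} [MeasurableSpace X] {ν : Measure X}
    {f g : X → EuclideanSpace ℝ (Fin 4)} (hf : AEStronglyMeasurable f ν) (hg : AEStronglyMeasurable g ν)
    (hf2 : Integrable (fun x => ‖f x‖ ^ 2) ν) (hg2 : Integrable (fun x => ‖g x‖ ^ 2) ν) :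
    Integrable (fun x => ⟪f x, g x⟫) ν := by
  refine Integrable.mono' ((hf2.add hg2).div_const 2) (hf.inner hg) (Eventually.of_forall fun x => ?_)
  rw [Real.norm_eq_abs]
  have h1 := abs_real_inner_le_norm (f x) (g x)
  have h2 : ‖f x‖ * ‖g x‖ ≤ (‖f x‖ ^ 2 + ‖g x‖ ^ 2) / 2 := by nlinarith [sq_nonneg (‖f x‖ - ‖g x‖)]
  simpa only [Pi.add_apply] using h1.trans h2

/-- **Strong `L²` convergence passes bounded scalar weights to the limit**: if `∫_S ‖w_k − U‖² → 0` on a set of finite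
volume, `‖w_k‖, ‖U‖ ≤ 1`, and `|c| ≤ C`, then `∫_S c • w_k → ∫_S c • U`. [cite: Evans2010, §5.7 Theorem 1] -/
theorem tendsto_setIntegral_smul_of_sq {S : Set (EuclideanSpace ℝ (Fin 3))} (hS : volume S < ⊤) (hSm : MeasurableSet S)
    {c : EuclideanSpace ℝ (Fin 3) → ℝ} {C : ℝ} (hcm : AEStronglyMeasurable c (volume.restrict S)) (hcC : ∀ x, |c x| ≤ C)
    {w : ℕ → EuclideanSpace ℝ (Fin 3) → EuclideanSpace ℝ (Fin 4)} {U : EuclideanSpace ℝ (Fin 3) → EuclideanSpace ℝ (Fin 4)}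
    (hwm : ∀ k, AEStronglyMeasurable (w k) (volume.restrict S)) (hUm : AEStronglyMeasurable U (volume.restrict S))
    (hw1 : ∀ k x, x ∈ S → ‖w k x‖ ≤ 1) (hU1 : ∀ x, ‖U x‖ ≤ 1)
    (h2 : Tendsto (fun k => ∫ x in S, ‖w k x - U x‖ ^ 2) atTop (𝓝 0)) :
    Tendsto (fun k => ∫ x in S, c x • w k x) atTop (𝓝 (∫ x in S, c x • U x)) := by
  haveI : IsFiniteMeasure (volume.restrict S) := isFiniteMeasure_restrict.2 hS.ne
  have hd2 : ∀ k, ∀ᵐ x ∂(volume.restrict S), ‖w k x - U x‖ ≤ 2 := fun k => by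
    filter_upwards [ae_restrict_mem hSm] with x hx
    calc ‖w k x - U x‖ ≤ ‖w k x‖ + ‖U x‖ := norm_sub_le _ _
      _ ≤ 1 + 1 := add_le_add (hw1 k x hx) (hU1 x)
      _ = 2 := by norm_num
  have h1 : Tendsto (fun k => ∫ x in S, ‖w k x - U x‖) atTop (𝓝 0) :=
    tendsto_setIntegral_norm_of_sq hS (fun k => (hwm k).sub hUm) hd2 h2
  have hC : ∀ x, |c x| ≤ |C| := fun x => (hcC x).trans (le_abs_self C)
  have hIw : ∀ k, Integrable (fun x => c x • w k x) (volume.restrict S) := fun k =>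
    integrable_of_norm_le (hcm.smul (hwm k)) (|C| * 1) (by
      filter_upwards [ae_restrict_mem hSm] with x hx
      rw [norm_smul, Real.norm_eq_abs]
      exact mul_le_mul (hC x) (hw1 k x hx) (norm_nonneg _) (abs_nonneg _))
  have hIU : Integrable (fun x => c x • U x) (volume.restrict S) :=
    integrable_of_norm_le (hcm.smul hUm) (|C| * 1) (Eventually.of_forall fun x => by
      rw [norm_smul, Real.norm_eq_abs]
      exact mul_le_mul (hC x) (hU1 x) (norm_nonneg _) (abs_nonneg _))
  have hId : ∀ k, Integrable (fun x => ‖w k x - U x‖) (volume.restrict S) := fun k =>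
    integrable_of_norm_le ((hwm k).sub hUm).norm 2 (by
      filter_upwards [hd2 k] with x hx; rwa [norm_norm])
  rw [tendsto_iff_norm_sub_tendsto_zero]
  refine squeeze_zero (fun k => norm_nonneg _) (fun k => ?_) (by simpa using h1.const_mul |C|)
  rw [← integral_sub (hIw k) hIU]
  calc ‖∫ x in S, (c x • w k x - c x • U x)‖ ≤ ∫ x in S, |C| * ‖w k x - U x‖ :=
        norm_integral_le_of_norm_le ((hId k).const_mul _) (Eventually.of_forall fun x => by
          rw [← smul_sub, norm_smul, Real.norm_eq_abs]
          exact mul_le_mul_of_nonneg_right (hC x) (norm_nonneg _))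
    _ = |C| * ∫ x in S, ‖w k x - U x‖ := integral_const_mul _ _

end Literature.Analysis.PDE.MinimisingMaps

end Part11

/-!
## Part 12 — port of `Summits/QuantumFields/YangMills/Theorems/PoincareLipschitzSobolevCubeExtraction.lean` (3 declarations kept)

# Energy minimising maps into `S³` (Hardt–Kinderlehrer–Lin / Luckhaus / Simon §2.9): Sobolev Cube Extraction

Declarations of this Part (verbatim port; each keeps its own docstring and citation): `hasWeakFDerivOn_of_limit_pairings`, `sum_setIntegral_sq_le_of_weak_pairing`, `exists_subseq_limit_weakGrad`.

Reference keys (see `references.bib` and the declarations' citations): [Simon1996], [HardtKinderlehrerLin1986], [Evans2010].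
-/

section Part12

open _root_.MeasureTheory _root_.Set _root_.Function _root_.Filter _root_.Topology _root_.Metric _root_.TopologicalSpace
open scoped _root_.ContDiff _root_.ENNReal RealInnerProductSpace _root_.BigOperators

namespace Literature.Analysis.PDE.MinimisingMaps

open Literature.Analysis.FunctionSpaces

/-! ## §4 Two assembly lemmas: the weak derivative of the limit, lower semicontinuity -/

-- nested operator types `(E →L[ℝ] ℝ) →L[ℝ] F →L[ℝ] E →L[ℝ] F` (`smulRightL`), as in lit `WeakDerivInner`
set_option maxSynthPendingDepth 3 in
/-- **The `L²` limit of unit maps inherits the weak gradient `v ↦ Σ_μ v_μ • G_μ`** when, for every direction `μ` and every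
bounded measurable scalar weight `θ`, `∫_Q θ • (Gs_k e_μ) → ∫_Q θ • G_μ` (integration by parts passes to the limit: the
left sides `∫_Q ∂_μθ • u_k` converge by strong `L²` convergence). [cite: Evans2010, §5.8.2 Theorem 3] -/
theorem hasWeakFDerivOn_of_limit_pairings (hQ : IsOpen {x : EuclideanSpace ℝ (Fin 3) | ∀ i : Fin 3, |x i| < 1})
    {u : ℕ → EuclideanSpace ℝ (Fin 3) → EuclideanSpace ℝ (Fin 4)}
    {Gs : ℕ → EuclideanSpace ℝ (Fin 3) → (EuclideanSpace ℝ (Fin 3) →L[ℝ] EuclideanSpace ℝ (Fin 4))}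
    (hu : ∀ k, HasWeakFDerivOn ⟨{x : EuclideanSpace ℝ (Fin 3) | ∀ i : Fin 3, |x i| < 1}, hQ⟩ volume (u k) (Gs k))
    (hu1 : ∀ k (x : EuclideanSpace ℝ (Fin 3)), (∀ i : Fin 3, |x i| < 1) → ‖u k x‖ = 1)
    {U : EuclideanSpace ℝ (Fin 3) → EuclideanSpace ℝ (Fin 4)} (hUm : Measurable U) (hU1 : ∀ x, ‖U x‖ = 1)
    (hL2 : Tendsto (fun k => ∫ x in {x : EuclideanSpace ℝ (Fin 3) | ∀ i : Fin 3, |x i| < 1}, ‖u k x - U x‖ ^ 2) atTop (𝓝 0))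
    {Gc : Fin 3 → EuclideanSpace ℝ (Fin 3) → EuclideanSpace ℝ (Fin 4)}
    (hGc : ∀ μ, IntegrableOn (Gc μ) {x : EuclideanSpace ℝ (Fin 3) | ∀ i : Fin 3, |x i| < 1} volume)
    (hpair : ∀ (μ : Fin 3) (θ : EuclideanSpace ℝ (Fin 3) → ℝ) (B : ℝ), AEStronglyMeasurable θ (volume.restrict {x : EuclideanSpace ℝ (Fin 3) | ∀ i : Fin 3, |x i| < 1}) →
      (∀ x, |θ x| ≤ B) →
      Tendsto (fun k => ∫ x in {x : EuclideanSpace ℝ (Fin 3) | ∀ i : Fin 3, |x i| < 1}, θ x • Gs k x (EuclideanSpace.single μ (1:ℝ))) atTop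
        (𝓝 (∫ x in {x : EuclideanSpace ℝ (Fin 3) | ∀ i : Fin 3, |x i| < 1}, θ x • Gc μ x))) :
    HasWeakFDerivOn ⟨{x : EuclideanSpace ℝ (Fin 3) | ∀ i : Fin 3, |x i| < 1}, hQ⟩ volume U
      (fun x => ∑ μ : Fin 3, (EuclideanSpace.proj μ).smulRight (Gc μ x)) := by
  set Q : Set (EuclideanSpace ℝ (Fin 3)) := {x | ∀ i : Fin 3, |x i| < 1} with hQdef
  have hQm : MeasurableSet Q := hQ.measurableSet
  have hQfin : volume Q < ⊤ := volume_openCube_lt_top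
  haveI : IsFiniteMeasure (volume.restrict Q) := isFiniteMeasure_restrict.2 hQfin.ne
  have humeas : ∀ k, AEStronglyMeasurable (u k) (volume.restrict Q) :=
    fun k => (hu k).locallyIntegrableOn.aestronglyMeasurable
  have hUint : IntegrableOn U Q volume :=
    integrable_of_norm_le hUm.aestronglyMeasurable 1 (Eventually.of_forall fun x => (hU1 x).le)
  have hG1 : ∀ μ : Fin 3, IntegrableOn (fun x =>
      ((EuclideanSpace.proj μ : EuclideanSpace ℝ (Fin 3) →L[ℝ] ℝ)).smulRight (Gc μ x)) Q volume := by
    intro μ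
    refine Integrable.mono' ((hGc μ).norm.const_mul ‖(EuclideanSpace.proj μ : EuclideanSpace ℝ (Fin 3) →L[ℝ] ℝ)‖) ?_ ?_
    · exact (ContinuousLinearMap.smulRightL ℝ (EuclideanSpace ℝ (Fin 3)) (EuclideanSpace ℝ (Fin 4))
        (EuclideanSpace.proj μ : EuclideanSpace ℝ (Fin 3) →L[ℝ] ℝ)).continuous.comp_aestronglyMeasurable
        (hGc μ).aestronglyMeasurable
    · exact Eventually.of_forall fun x => (ContinuousLinearMap.norm_smulRight_apply _ _).le
  have hGint : IntegrableOn (fun x => ∑ μ : Fin 3,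
      ((EuclideanSpace.proj μ : EuclideanSpace ℝ (Fin 3) →L[ℝ] ℝ)).smulRight (Gc μ x)) Q volume := by
    simp only [Fin.sum_univ_three]
    exact ((hG1 0).add (hG1 1)).add (hG1 2)
  -- integration by parts per direction, in the limit
  have hper : ∀ (μ : Fin 3) (θ : EuclideanSpace ℝ (Fin 3) → ℝ), IsTestFunctionOn ⟨Q, hQ⟩ θ →
      ∫ x in Q, (fderiv ℝ θ x (EuclideanSpace.single μ (1:ℝ))) • U x = -∫ x in Q, θ x • Gc μ x := by
    intro μ θ hθ
    obtain ⟨L', hL'⟩ := (hθ.hasCompactSupport.fderiv (𝕜 := ℝ)).exists_bound_of_continuous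
      ((hθ.contDiff.of_le (by exact_mod_cast le_top) : ContDiff ℝ 1 θ).continuous_fderiv one_ne_zero)
    obtain ⟨B', hB'⟩ := hθ.hasCompactSupport.exists_bound_of_continuous hθ.contDiff.continuous
    have hDc : Continuous fun y => fderiv ℝ θ y (EuclideanSpace.single μ (1:ℝ)) :=
      (((hθ.contDiff.of_le (by exact_mod_cast le_top) : ContDiff ℝ 1 θ)).continuous_fderiv one_ne_zero).clm_apply
        continuous_const
    have hDb : ∀ y, |fderiv ℝ θ y (EuclideanSpace.single μ (1:ℝ))| ≤ L' * ‖EuclideanSpace.single μ (1:ℝ)‖ := fun y => by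
      rw [← Real.norm_eq_abs]
      exact (ContinuousLinearMap.le_opNorm _ _).trans (mul_le_mul_of_nonneg_right (hL' y) (norm_nonneg _))
    have hlhs : Tendsto (fun k => ∫ x in Q, (fderiv ℝ θ x (EuclideanSpace.single μ (1:ℝ))) • u k x) atTop
        (𝓝 (∫ x in Q, (fderiv ℝ θ x (EuclideanSpace.single μ (1:ℝ))) • U x)) :=
      tendsto_setIntegral_smul_of_sq hQfin hQm hDc.aestronglyMeasurable hDb humeas hUm.aestronglyMeasurable
        (fun k x hx => (hu1 k x hx).le) (fun x => (hU1 x).le) hL2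
    have hrhs : Tendsto (fun k => -∫ x in Q, θ x • Gs k x (EuclideanSpace.single μ (1:ℝ))) atTop
        (𝓝 (-∫ x in Q, θ x • Gc μ x)) :=
      (hpair μ θ B' hθ.contDiff.continuous.aestronglyMeasurable fun x => by
        rw [← Real.norm_eq_abs]; exact hB' x).neg
    have heq : ∀ k, ∫ x in Q, (fderiv ℝ θ x (EuclideanSpace.single μ (1:ℝ))) • u k x =
        -∫ x in Q, θ x • Gs k x (EuclideanSpace.single μ (1:ℝ)) :=
      fun k => (hu k).integral_fderiv_smul_eq θ (EuclideanSpace.single μ (1:ℝ)) hθ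
    exact tendsto_nhds_unique hlhs (by simp_rw [heq]; exact hrhs)
  refine ⟨hUint.locallyIntegrableOn, hGint.locallyIntegrableOn, fun θ v hθ => ?_⟩
  have hv : v = ∑ μ : Fin 3, v μ • EuclideanSpace.single μ (1:ℝ) := by
    simpa using ((EuclideanSpace.basisFun (Fin 3) ℝ).sum_repr v).symm
  have hlhs : ∀ x, (fderiv ℝ θ x v) • U x =
      ∑ μ : Fin 3, v μ • ((fderiv ℝ θ x (EuclideanSpace.single μ (1:ℝ))) • U x) := by
    intro x
    conv_lhs => rw [hv]
    rw [map_sum, Finset.sum_smul]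
    refine Finset.sum_congr rfl fun μ _ => ?_
    rw [map_smul, smul_eq_mul, mul_smul]
  have hrhs : ∀ x, θ x • (∑ μ : Fin 3, (EuclideanSpace.proj μ).smulRight (Gc μ x)) v =
      ∑ μ : Fin 3, v μ • (θ x • Gc μ x) := by
    intro x
    rw [sum_smulRight_apply, Finset.smul_sum]
    refine Finset.sum_congr rfl fun μ _ => ?_
    rw [smul_comm]
  obtain ⟨L', hL'⟩ := (hθ.hasCompactSupport.fderiv (𝕜 := ℝ)).exists_bound_of_continuous
    ((hθ.contDiff.of_le (by exact_mod_cast le_top) : ContDiff ℝ 1 θ).continuous_fderiv one_ne_zero)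
  have hDc : ∀ μ : Fin 3, Continuous fun y => fderiv ℝ θ y (EuclideanSpace.single μ (1:ℝ)) := fun μ =>
    (((hθ.contDiff.of_le (by exact_mod_cast le_top) : ContDiff ℝ 1 θ)).continuous_fderiv one_ne_zero).clm_apply
      continuous_const
  have hI1 : ∀ μ : Fin 3, Integrable (fun x => (fderiv ℝ θ x (EuclideanSpace.single μ (1:ℝ))) • U x)
      (volume.restrict Q) := by
    intro μ
    refine integrable_of_norm_le ((hDc μ).aestronglyMeasurable.smul hUm.aestronglyMeasurable)
      (L' * ‖EuclideanSpace.single μ (1:ℝ)‖) (Eventually.of_forall fun y => ?_)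
    rw [norm_smul, hU1 y, mul_one]
    exact (ContinuousLinearMap.le_opNorm _ _).trans (mul_le_mul_of_nonneg_right (hL' y) (norm_nonneg _))
  have hI2 : ∀ μ : Fin 3, Integrable (fun x => θ x • Gc μ x) (volume.restrict Q) := fun μ =>
    integrableOn_smul_of_tsupport_subset (Ω := ⟨Q, hQ⟩) hθ.contDiff.continuous hθ.hasCompactSupport
      hθ.tsupport_subset (hGc μ).locallyIntegrableOn
  show ∫ x in Q, (fderiv ℝ θ x v) • U x = -∫ x in Q, θ x • (∑ μ : Fin 3, (EuclideanSpace.proj μ).smulRight (Gc μ x)) v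
  simp_rw [hlhs, hrhs]
  have hs1 : ∫ x in Q, ∑ μ : Fin 3, v μ • ((fderiv ℝ θ x (EuclideanSpace.single μ (1:ℝ))) • U x) =
      ∑ μ : Fin 3, ∫ x in Q, v μ • ((fderiv ℝ θ x (EuclideanSpace.single μ (1:ℝ))) • U x) :=
    integral_finsetSum _ fun μ _ => (hI1 μ).smul (v μ)
  have hs2 : ∫ x in Q, ∑ μ : Fin 3, v μ • (θ x • Gc μ x) = ∑ μ : Fin 3, ∫ x in Q, v μ • (θ x • Gc μ x) :=
    integral_finsetSum _ fun μ _ => (hI2 μ).smul (v μ)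
  rw [hs1, hs2, ← Finset.sum_neg_distrib]
  refine Finset.sum_congr rfl fun μ _ => ?_
  rw [integral_smul, integral_smul, hper μ θ hθ, smul_neg]

/-- **Lower semicontinuity of the energy under weak `L²` convergence of the components, by Cauchy–Schwarz absorption**:
if `∫_Q ⟪ψ, v_k^i⟫ → ∫_Q ⟪ψ, G_i⟫` for all `ψ ∈ L²(Q)` and `∫_S Σ_i ‖v_k^i‖² ≤ M` for infinitely many `k` (`S ⊆ Q`
measurable), then `Σ_i ∫_S ‖G_i‖² ≤ M` (test with `ψ := 1_S G_i`: the limit `a` obeys `a ≤ (a + M)/2`). [cite: Evans2010, §5.8.2 Theorem 3] -/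
theorem sum_setIntegral_sq_le_of_weak_pairing
    {Gc : Fin 3 → EuclideanSpace ℝ (Fin 3) → EuclideanSpace ℝ (Fin 4)}
    (hGcMem : ∀ i, MemLp (Gc i) 2 (volume.restrict {x : EuclideanSpace ℝ (Fin 3) | ∀ i : Fin 3, |x i| < 1}))
    {v : ℕ → Fin 3 → EuclideanSpace ℝ (Fin 3) → EuclideanSpace ℝ (Fin 4)}
    (hvMem : ∀ k i, MemLp (v k i) 2 (volume.restrict {x : EuclideanSpace ℝ (Fin 3) | ∀ i : Fin 3, |x i| < 1}))
    (hGcψ : ∀ (i : Fin 3) (ψ : EuclideanSpace ℝ (Fin 3) → EuclideanSpace ℝ (Fin 4)),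
      MemLp ψ 2 (volume.restrict {x : EuclideanSpace ℝ (Fin 3) | ∀ i : Fin 3, |x i| < 1}) →
      Tendsto (fun k => ∫ x in {x : EuclideanSpace ℝ (Fin 3) | ∀ i : Fin 3, |x i| < 1}, ⟪ψ x, v k i x⟫) atTop (𝓝 (∫ x in {x : EuclideanSpace ℝ (Fin 3) | ∀ i : Fin 3, |x i| < 1}, ⟪ψ x, Gc i x⟫)))
    {S : Set (EuclideanSpace ℝ (Fin 3))} (hS : MeasurableSet S) (hSQ : S ⊆ {x : EuclideanSpace ℝ (Fin 3) | ∀ i : Fin 3, |x i| < 1}) {M : ℝ}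
    (hM : ∃ᶠ k in atTop, ∫ x in S, ∑ i : Fin 3, ‖v k i x‖ ^ 2 ≤ M) :
    ∑ i : Fin 3, ∫ x in S, ‖Gc i x‖ ^ 2 ≤ M := by
  set Q : Set (EuclideanSpace ℝ (Fin 3)) := {x | ∀ i : Fin 3, |x i| < 1} with hQdef
  have hνle : volume.restrict S ≤ volume.restrict Q := Measure.restrict_mono hSQ le_rfl
  have hGci2 : ∀ i, Integrable (fun x => ‖Gc i x‖ ^ 2) (volume.restrict Q) := fun i =>
    (memLp_two_iff_integrable_sq_norm (hGcMem i).1).1 (hGcMem i)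
  have hv2 : ∀ k i, Integrable (fun x => ‖v k i x‖ ^ 2) (volume.restrict Q) := fun k i =>
    (memLp_two_iff_integrable_sq_norm (hvMem k i).1).1 (hvMem k i)
  have hGcS2 : ∀ i, Integrable (fun x => ‖Gc i x‖ ^ 2) (volume.restrict S) := fun i => (hGci2 i).mono_measure hνle
  have hvS2 : ∀ k i, Integrable (fun x => ‖v k i x‖ ^ 2) (volume.restrict S) :=
    fun k i => (hv2 k i).mono_measure hνle
  have hGcSm : ∀ i, AEStronglyMeasurable (Gc i) (volume.restrict S) := fun i => (hGcMem i).1.mono_measure hνle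
  have hvSm : ∀ k i, AEStronglyMeasurable (v k i) (volume.restrict S) := fun k i => (hvMem k i).1.mono_measure hνle
  -- the pairings `∫_S ⟪Gc i, v_k^i⟫ → ∫_S ‖Gc i‖²`
  have hpair : ∀ i, Tendsto (fun k => ∫ x in S, ⟪Gc i x, v k i x⟫) atTop (𝓝 (∫ x in S, ‖Gc i x‖ ^ 2)) := by
    intro i
    have h := hGcψ i (S.indicator (Gc i)) ((hGcMem i).indicator hS)
    have h1 : ∀ (w : EuclideanSpace ℝ (Fin 3) → EuclideanSpace ℝ (Fin 4)),
        ∫ x in Q, ⟪S.indicator (Gc i) x, w x⟫ = ∫ x in S, ⟪Gc i x, w x⟫ := by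
      intro w
      have h2 : (fun x => ⟪S.indicator (Gc i) x, w x⟫) = S.indicator (fun x => ⟪Gc i x, w x⟫) := by
        funext x
        by_cases hx : x ∈ S
        · rw [Set.indicator_of_mem hx, Set.indicator_of_mem hx]
        · rw [Set.indicator_of_notMem hx, Set.indicator_of_notMem hx, inner_zero_left]
      rw [h2, setIntegral_indicator hS, inter_eq_self_of_subset_right hSQ]
    have h3 : ∫ x in S, ⟪Gc i x, Gc i x⟫ = ∫ x in S, ‖Gc i x‖ ^ 2 := by
      refine integral_congr_ae (Eventually.of_forall fun x => ?_)
      simp only [real_inner_self_eq_norm_sq]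
    rw [h1 (Gc i), h3] at h
    exact h.congr fun k => h1 (v k i)
  have hsum : Tendsto (fun k => ∑ i : Fin 3, ∫ x in S, ⟪Gc i x, v k i x⟫) atTop
      (𝓝 (∑ i : Fin 3, ∫ x in S, ‖Gc i x‖ ^ 2)) := tendsto_finsetSum _ fun i _ => hpair i
  -- the absorption bound, frequently
  have hbound : ∃ᶠ k in atTop, ∑ i : Fin 3, ∫ x in S, ⟪Gc i x, v k i x⟫ ≤
      ((∑ i : Fin 3, ∫ x in S, ‖Gc i x‖ ^ 2) + M) / 2 := by
    refine hM.mono fun k hk => ?_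
    have h1 : ∀ i, ∫ x in S, ⟪Gc i x, v k i x⟫ ≤ ∫ x in S, (‖Gc i x‖ ^ 2 + ‖v k i x‖ ^ 2) / 2 := fun i =>
      integral_mono (integrable_real_inner_of_sq (hGcSm i) (hvSm k i) (hGcS2 i) (hvS2 k i))
        (((hGcS2 i).add (hvS2 k i)).div_const 2) fun x => by
          have := real_inner_le_norm (Gc i x) (v k i x)
          nlinarith [sq_nonneg (‖Gc i x‖ - ‖v k i x‖)]
    have h2 : ∀ i, ∫ x in S, (‖Gc i x‖ ^ 2 + ‖v k i x‖ ^ 2) / 2 =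
        ((∫ x in S, ‖Gc i x‖ ^ 2) + ∫ x in S, ‖v k i x‖ ^ 2) / 2 := fun i => by
      rw [integral_div, integral_add (hGcS2 i) (hvS2 k i)]
    have h3 : ∑ i : Fin 3, ∫ x in S, ‖v k i x‖ ^ 2 = ∫ x in S, ∑ i : Fin 3, ‖v k i x‖ ^ 2 :=
      (integral_finsetSum _ fun i _ => hvS2 k i).symm
    have h4 : ∑ i : Fin 3, ∫ x in S, ⟪Gc i x, v k i x⟫ ≤
        ∑ i : Fin 3, ((∫ x in S, ‖Gc i x‖ ^ 2) + ∫ x in S, ‖v k i x‖ ^ 2) / 2 :=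
      Finset.sum_le_sum fun i _ => (h1 i).trans (le_of_eq (h2 i))
    rw [← Finset.sum_div, Finset.sum_add_distrib, h3] at h4
    linarith
  have hle := isClosed_Iic.mem_of_frequently_of_tendsto hbound hsum
  rw [mem_Iic] at hle
  linarith

/-! ## §5 The extraction theorem on the cube -/

/-- **(C-a3) EXTRACTION ON THE CUBE.**  Let `u_j : Q → S³ ⊂ ℝ⁴` (`Q` the open unit cube of `ℝ³`) have weak gradients
`Gs_j` on `Q` with `∫_Q Σ_i ‖Gs_j e_i‖² ≤ Λ`.  Then along a subsequence `φ` there are a measurable, everywhere-unit `U` and a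
field `G` with: `U` has weak gradient `G` on `Q` (lit `HasWeakFDerivOn`); `Σ_i ‖G e_i‖²` is integrable on `Q`; `u_{φ j} → U`
a.e. on `Q` and in `L²(Q)`; the components `Gs_{φ j} e_i ⇀ G e_i` weakly in `L²(Q; ℝ⁴)`; and the energy is lower
semicontinuous on every measurable `S ⊆ Q`: if `∫_S Σ_i ‖Gs_{φ j} e_i‖² ≤ M` for infinitely many `j` then
`∫_S Σ_i ‖G e_i‖² ≤ M`.  (Rellich via (C-a1)/(C-a2), Cantor diagonal on the dyadic means, (Γ2-W) weak limit per direction,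
integration by parts in the limit, Cauchy–Schwarz absorption.) [cite: Evans2010, §5.7 Theorem 1; §5.8.2 Theorem 3] -/
theorem exists_subseq_limit_weakGrad (hQ : IsOpen {x : EuclideanSpace ℝ (Fin 3) | ∀ i : Fin 3, |x i| < 1})
    (u : ℕ → EuclideanSpace ℝ (Fin 3) → EuclideanSpace ℝ (Fin 4))
    (Gs : ℕ → EuclideanSpace ℝ (Fin 3) → (EuclideanSpace ℝ (Fin 3) →L[ℝ] EuclideanSpace ℝ (Fin 4))) (Λ : ℝ)
    (hu : ∀ j, HasWeakFDerivOn ⟨{x : EuclideanSpace ℝ (Fin 3) | ∀ i : Fin 3, |x i| < 1}, hQ⟩ volume (u j) (Gs j))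
    (hu1 : ∀ j (x : EuclideanSpace ℝ (Fin 3)), (∀ i : Fin 3, |x i| < 1) → ‖u j x‖ = 1)
    (hGi : ∀ j, IntegrableOn (fun x => ∑ i : Fin 3, ‖Gs j x (EuclideanSpace.single i (1:ℝ))‖ ^ 2) {x : EuclideanSpace ℝ (Fin 3) | ∀ i : Fin 3, |x i| < 1} volume)
    (hΛ : ∀ j, ∫ x in {x : EuclideanSpace ℝ (Fin 3) | ∀ i : Fin 3, |x i| < 1}, ∑ i : Fin 3, ‖Gs j x (EuclideanSpace.single i (1:ℝ))‖ ^ 2 ≤ Λ) :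
    ∃ (U : EuclideanSpace ℝ (Fin 3) → EuclideanSpace ℝ (Fin 4))
      (G : EuclideanSpace ℝ (Fin 3) → (EuclideanSpace ℝ (Fin 3) →L[ℝ] EuclideanSpace ℝ (Fin 4))) (φ : ℕ → ℕ),
      StrictMono φ ∧ Measurable U ∧
      HasWeakFDerivOn ⟨{x : EuclideanSpace ℝ (Fin 3) | ∀ i : Fin 3, |x i| < 1}, hQ⟩ volume U G ∧
      (∀ x, ‖U x‖ = 1) ∧
      IntegrableOn (fun x => ∑ i : Fin 3, ‖G x (EuclideanSpace.single i (1:ℝ))‖ ^ 2) {x : EuclideanSpace ℝ (Fin 3) | ∀ i : Fin 3, |x i| < 1} volume ∧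
      (∀ᵐ x ∂(volume.restrict {x : EuclideanSpace ℝ (Fin 3) | ∀ i : Fin 3, |x i| < 1}), Tendsto (fun j => u (φ j) x) atTop (𝓝 (U x))) ∧
      Tendsto (fun j => ∫ x in {x : EuclideanSpace ℝ (Fin 3) | ∀ i : Fin 3, |x i| < 1}, ‖u (φ j) x - U x‖ ^ 2) atTop (𝓝 0) ∧
      (∀ (i : Fin 3) (ψ : EuclideanSpace ℝ (Fin 3) → EuclideanSpace ℝ (Fin 4)), MemLp ψ 2 (volume.restrict {x : EuclideanSpace ℝ (Fin 3) | ∀ i : Fin 3, |x i| < 1}) →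
        Tendsto (fun j => ∫ x in {x : EuclideanSpace ℝ (Fin 3) | ∀ i : Fin 3, |x i| < 1}, ⟪ψ x, Gs (φ j) x (EuclideanSpace.single i (1:ℝ))⟫) atTop
          (𝓝 (∫ x in {x : EuclideanSpace ℝ (Fin 3) | ∀ i : Fin 3, |x i| < 1}, ⟪ψ x, G x (EuclideanSpace.single i (1:ℝ))⟫))) ∧
      (∀ S : Set (EuclideanSpace ℝ (Fin 3)), MeasurableSet S → S ⊆ {x : EuclideanSpace ℝ (Fin 3) | ∀ i : Fin 3, |x i| < 1} →
        ∀ M : ℝ, (∃ᶠ j in atTop, ∫ x in S, ∑ i : Fin 3, ‖Gs (φ j) x (EuclideanSpace.single i (1:ℝ))‖ ^ 2 ≤ M) →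
          ∫ x in S, ∑ i : Fin 3, ‖G x (EuclideanSpace.single i (1:ℝ))‖ ^ 2 ≤ M) := by
  set Q : Set (EuclideanSpace ℝ (Fin 3)) := {x | ∀ i : Fin 3, |x i| < 1} with hQdef
  have hQm : MeasurableSet Q := hQ.measurableSet
  have hQfin : volume Q < ⊤ := volume_openCube_lt_top
  haveI : IsFiniteMeasure (volume.restrict Q) := isFiniteMeasure_restrict.2 hQfin.ne
  -- §2: strong `L²` limit with a unit representative
  obtain ⟨U, φ₁, hφ₁, hUm, hU1, hae₁, hL2₁⟩ := exists_subseq_unit_limit hQ u Gs Λ hu hu1 hGi hΛ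
  -- the components of the gradients lie in `L²(Q; ℝ⁴)` with `∫_Q ‖·‖² ≤ Λ`
  have hvm : ∀ j i, AEStronglyMeasurable (fun x => Gs j x (EuclideanSpace.single i (1:ℝ))) (volume.restrict Q) :=
    fun j i => (hu j).aestronglyMeasurable_deriv_apply (EuclideanSpace.single i (1:ℝ))
  have hv_le : ∀ j i x, ‖Gs j x (EuclideanSpace.single i (1:ℝ))‖ ^ 2 ≤
      ∑ i' : Fin 3, ‖Gs j x (EuclideanSpace.single i' (1:ℝ))‖ ^ 2 := fun j i x =>
    Finset.single_le_sum (f := fun i' => ‖Gs j x (EuclideanSpace.single i' (1:ℝ))‖ ^ 2) (fun i' _ => sq_nonneg _)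
      (Finset.mem_univ i)
  have hv2 : ∀ j i, Integrable (fun x => ‖Gs j x (EuclideanSpace.single i (1:ℝ))‖ ^ 2) (volume.restrict Q) :=
    fun j i => (hGi j).mono' ((hvm j i).norm.pow 2) (Eventually.of_forall fun x => by
      rw [Real.norm_eq_abs, abs_of_nonneg (sq_nonneg _)]; exact hv_le j i x)
  have hvMem : ∀ j i, MemLp (fun x => Gs j x (EuclideanSpace.single i (1:ℝ))) 2 (volume.restrict Q) := fun j i =>
    (memLp_two_iff_integrable_sq_norm (hvm j i)).2 (hv2 j i)
  have hvΛ : ∀ j i, ∫ x in Q, ‖Gs j x (EuclideanSpace.single i (1:ℝ))‖ ^ 2 ≤ Λ := fun j i =>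
    (integral_mono (hv2 j i) (hGi j) fun x => hv_le j i x).trans (hΛ j)
  -- the dyadic means are bounded by `R := vol(Q) + Λ`
  set R : ℝ := volume.real Q + Λ with hR
  have hL1 : ∀ j i, ∫ x in Q, ‖Gs j x (EuclideanSpace.single i (1:ℝ))‖ ≤ R := by
    intro j i
    have hpt : ∀ x, ‖Gs j x (EuclideanSpace.single i (1:ℝ))‖ ≤ 1 + ‖Gs j x (EuclideanSpace.single i (1:ℝ))‖ ^ 2 :=
      fun x => by
        nlinarith [norm_nonneg (Gs j x (EuclideanSpace.single i (1:ℝ))),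
          sq_nonneg (‖Gs j x (EuclideanSpace.single i (1:ℝ))‖ - 1)]
    calc ∫ x in Q, ‖Gs j x (EuclideanSpace.single i (1:ℝ))‖
        ≤ ∫ x in Q, (1 + ‖Gs j x (EuclideanSpace.single i (1:ℝ))‖ ^ 2) :=
          integral_mono_of_nonneg (Eventually.of_forall fun x => norm_nonneg _)
            ((integrable_const _).add (hv2 j i)) (Eventually.of_forall hpt)
      _ = volume.real Q + ∫ x in Q, ‖Gs j x (EuclideanSpace.single i (1:ℝ))‖ ^ 2 := by
          rw [integral_add (integrable_const _) (hv2 j i), setIntegral_const, smul_eq_mul, mul_one]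
      _ ≤ R := add_le_add le_rfl (hvΛ j i)
  have hcell : ∀ (j : ℕ) (i : Fin 3) (m : ℕ) (c : Fin 3 → Fin (2 ^ m)),
      ‖∫ x in {x : EuclideanSpace ℝ (Fin 3) | ∀ l : Fin 3,
        (-1 : ℝ) + 2 * (c l : ℕ) / (2 : ℝ) ^ m ≤ x l ∧ x l < (-1 : ℝ) + 2 * ((c l : ℕ) + 1) / (2 : ℝ) ^ m},
        Gs j x (EuclideanSpace.single i (1:ℝ))‖ ≤ R := by
    intro j i m c
    rw [← restrict_openCube_restrict_dyadicCell m c]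
    calc ‖∫ x, Gs j x (EuclideanSpace.single i (1:ℝ)) ∂((volume.restrict Q).restrict _)‖
        ≤ ∫ x, ‖Gs j x (EuclideanSpace.single i (1:ℝ))‖ ∂((volume.restrict Q).restrict _) :=
          norm_integral_le_integral_norm _
      _ ≤ ∫ x in Q, ‖Gs j x (EuclideanSpace.single i (1:ℝ))‖ := integral_mono_measure Measure.restrict_le_self
          (Eventually.of_forall fun x => norm_nonneg _) ((hvMem j i).integrable one_le_two).norm
      _ ≤ R := hL1 j i
  -- Cantor diagonal: a further subsequence along which every dyadic mean of every component converges
  obtain ⟨ψ, hψ, hψlim⟩ := exists_strictMono_forall_tendsto (ι := Fin 3 × ((m : ℕ) × (Fin 3 → Fin (2 ^ m))))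
    (F := EuclideanSpace ℝ (Fin 4))
    (fun k p => ∫ x in {x : EuclideanSpace ℝ (Fin 3) | ∀ l : Fin 3,
      (-1 : ℝ) + 2 * (p.2.2 l : ℕ) / (2 : ℝ) ^ p.2.1 ≤ x l ∧ x l < (-1 : ℝ) + 2 * ((p.2.2 l : ℕ) + 1) / (2 : ℝ) ^ p.2.1},
      Gs (φ₁ k) x (EuclideanSpace.single p.1 (1:ℝ)))
    (fun p => ⟨0, R, fun k => by rw [mem_closedBall, dist_zero_right]; exact hcell _ _ _ _⟩)
  set φ : ℕ → ℕ := φ₁ ∘ ψ with hφdef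
  have hφ : StrictMono φ := hφ₁.comp hψ
  -- (Γ2-W) per direction
  choose Gc hGcMem hGcΛ hGcMean hGcψ hGcφ using fun i : Fin 3 =>
    exists_weakLimit_of_dyadicMeans (fun k x => Gs (φ k) x (EuclideanSpace.single i (1:ℝ))) (fun k => hvMem (φ k) i) Λ
      (fun k => hvΛ (φ k) i) (fun m c => hψlim ⟨i, m, c⟩)
  -- the bundled gradient
  set G : EuclideanSpace ℝ (Fin 3) → (EuclideanSpace ℝ (Fin 3) →L[ℝ] EuclideanSpace ℝ (Fin 4)) :=
    fun x => ∑ μ : Fin 3, (EuclideanSpace.proj μ).smulRight (Gc μ x) with hGdef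
  have hGe : ∀ x i, G x (EuclideanSpace.single i (1:ℝ)) = Gc i x := fun x i => sum_smulRight_apply_single Gc x i
  have hGci2 : ∀ i, Integrable (fun x => ‖Gc i x‖ ^ 2) (volume.restrict Q) := fun i =>
    (memLp_two_iff_integrable_sq_norm (hGcMem i).1).1 (hGcMem i)
  -- rows along `φ`
  have hae : ∀ᵐ x ∂(volume.restrict Q), Tendsto (fun j => u (φ j) x) atTop (𝓝 (U x)) := by
    filter_upwards [hae₁] with x hx using hx.comp hψ.tendsto_atTop
  have hL2 : Tendsto (fun j => ∫ x in Q, ‖u (φ j) x - U x‖ ^ 2) atTop (𝓝 0) := hL2₁.comp hψ.tendsto_atTop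
  -- the weak derivative of `U` (§4)
  have hW : HasWeakFDerivOn ⟨Q, hQ⟩ volume U G :=
    hasWeakFDerivOn_of_limit_pairings hQ (fun k => hu (φ k)) (fun k x hx => hu1 (φ k) x hx) hUm hU1 hL2
      (fun μ => (hGcMem μ).integrable one_le_two) hGcφ
  -- the density of `G` is integrable
  have hGdens : IntegrableOn (fun x => ∑ i : Fin 3, ‖G x (EuclideanSpace.single i (1:ℝ))‖ ^ 2) Q volume := by
    simp_rw [hGe]
    exact integrable_finsetSum _ fun i _ => hGci2 i
  refine ⟨U, G, φ, hφ, hUm, hW, hU1, hGdens, hae, hL2, fun i ψ' hψ' => ?_, fun S hS hSQ M hM => ?_⟩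
  · -- weak convergence of the components
    simp_rw [hGe]
    exact hGcψ i ψ' hψ'
  · -- lower semicontinuity on `S ⊆ Q` (§4)
    have ha : ∫ x in S, ∑ i : Fin 3, ‖G x (EuclideanSpace.single i (1:ℝ))‖ ^ 2 = ∑ i : Fin 3, ∫ x in S, ‖Gc i x‖ ^ 2 := by
      simp_rw [hGe]
      exact integral_finsetSum _ fun i _ => (hGci2 i).mono_measure (Measure.restrict_mono hSQ le_rfl)
    rw [ha]
    exact sum_setIntegral_sq_le_of_weak_pairing hGcMem (v := fun k i x => Gs (φ k) x (EuclideanSpace.single i (1:ℝ)))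
      (fun k i => hvMem (φ k) i) hGcψ hS hSQ hM

end Literature.Analysis.PDE.MinimisingMaps

end Part12

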